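import Literature.Barriers.CriticalPhenomena.SAPBuildingBlocksMoves
import HarnessLib

/-!
# Lemma 21, the enumeration: labelled patterns of building blocks, certified by the kernel

Companion of `Literature/Barriers/CriticalPhenomena/SAPBuildingBlocksMoves.lean` (A. Rechnitzer,
*Haruspicy 2*, J. Combin. Theory Ser. A 113 (2006) 520–546, arXiv:math/0406450v2, §3.3,
**Lemma 21**: the generating function of the 2-4-2 building blocks), which classifies the words of
`bbWords M t w` as the move words of valid building-block data `(isA, ℓ)` (`BBValid`: eight
signed runs of shape `A` or `B`, closed, self-avoiding). The printed proof of Lemma 21 sorts these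
polygons into "the four possible orientations", "5 polygons" and `A`/`B`/`C`-"frills" (Figures
11–13) and reads off a rational function; "one could find `T̂` using the theory of
`P`-partitions, and we used it to check the result". This file replaces the pictures by a
KERNEL-CERTIFIED enumeration:

* the ORDER PATTERN of valid data — the sequence of "events" `E` (which of the three cell rows
  carry a vertical bond in each of the distinct columns, from left to right; a code in `1…7`,
  bit `0` = bottom row, bit `1` = middle row, bit `2` = top row) together with the RANKS
  `r_j` of the columns of the eight vertical letters (`patOf`); valid data with a given
  labelled pattern `P = (isA, E, r)` are freely parametrised by the positive gaps `n_i` between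
  consecutive distinct columns (`ellOf`, `patOf_ellOf`, `ellOf_patOf`), under which the
  statistics are linear: `t = Σ n_i a_i`, `w = Σ n_i b_i`, `2M = Σ n_i cov_i` (`stats_ellOf`);
* the finite list `validPats` of the `540` labelled patterns of valid data, DEFINED as a filter
  (disjointness of the same-height runs, `valid8`; consistency of tags, `pconsistent`) of an
  exhaustive candidate list over all `2741` event sequences with `2, 4, 2` bonds in the three
  rows (`allSeqs`), COMPUTED by the kernel in fourteen chunks (`validPatsChunk_true_1`, …; each
  a `decide +kernel` of a few seconds) and proved COMPLETE (`patOf_mem_validPats`: every valid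
  datum has its pattern in the list) and SOUND (`bbValid_ellOf`);
* the resulting COUNT: `#bbWords M t w = Σ_{P ∈ validPats} #{n ∈ ℕ₊^{g_P - 1} : Σ n_i a_i = t,
  Σ n_i b_i = w, Σ n_i cov_i = 2M}` (`card_bbWords_eq_sum`), the input of the generating
  function computation of the sibling `SAPBuildingBlocksSeries` (`Rechnitzer2006_eq29_holds`).

## References

* A. Rechnitzer, *Haruspicy 2*, op. cit., §3.3, Lemma 21, Figures 11–13. [Rechnitzer2006Haruspicy2]
-/

namespace Literature.Barriers.CriticalPhenomena

namespace Haruspicy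

/-! ### The computable core: event sequences, candidate ranks, validity, patterns -/

section Core

/-- Bit `tag` of an event code (`0` = bottom row `B`, `1` = middle row `M`, `2` = top row `T`).
[cite: Rechnitzer2006Haruspicy2, Lemma 21] -/
def hasTag (tag e : ℕ) : Bool :=
  match tag with
  | 0 => e % 2 == 1
  | 1 => (e / 2) % 2 == 1
  | _ => (e / 4) % 2 == 1

/-- All sequences of events (codes `1…7`) using `nB, nM, nT` vertical bonds in the three rows
(fuel-structural recursion, so that the kernel evaluates it). [cite: Rechnitzer2006Haruspicy2, Lemma 21] -/
def seqs (fuel nB nM nT : ℕ) : List (List ℕ) :=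
  match fuel with
  | 0 => if nB == 0 && nM == 0 && nT == 0 then [[]] else []
  | f + 1 =>
    if nB == 0 && nM == 0 && nT == 0 then [[]] else
      (List.range 7).flatMap fun i =>
        let e := i + 1
        let dB := if hasTag 0 e then 1 else 0
        let dM := if hasTag 1 e then 1 else 0
        let dT := if hasTag 2 e then 1 else 0
        if (Nat.ble dB nB && Nat.ble dM nM && Nat.ble dT nT) then
          (seqs f (nB - dB) (nM - dM) (nT - dT)).map (fun l => e :: l)
        else []
termination_by structural fuel

/-- The `2741` event sequences of a candidate building block: `2` bottom-row, `4` middle-row and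
`2` top-row vertical bonds. [cite: Rechnitzer2006Haruspicy2, Lemma 21] -/
def allSeqs : List (List ℕ) := seqs 8 2 4 2

/-- The event sequences whose first (leftmost) event is `e`. [cite: Rechnitzer2006Haruspicy2, Lemma 21] -/
def seqsChunk (e : ℕ) : List (List ℕ) :=
  (seqs 7 (2 - (if hasTag 0 e then 1 else 0)) (4 - (if hasTag 1 e then 1 else 0))
    (2 - (if hasTag 2 e then 1 else 0))).map (fun l => e :: l)

/-- The indices (from `i`) of the events carrying `tag`, in increasing order. [folklore] -/
def idxs (tag : ℕ) : List ℕ → ℕ → List ℕ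
  | [], _ => []
  | e :: E, i => if hasTag tag e then i :: idxs tag E (i + 1) else idxs tag E (i + 1)

/-- The `24` permutations of four indices. [folklore] -/
def perms4 : List (ℕ × ℕ × ℕ × ℕ) :=
  [(0,1,2,3),(0,1,3,2),(0,2,1,3),(0,2,3,1),(0,3,1,2),(0,3,2,1),
   (1,0,2,3),(1,0,3,2),(1,2,0,3),(1,2,3,0),(1,3,0,2),(1,3,2,0),
   (2,0,1,3),(2,0,3,1),(2,1,0,3),(2,1,3,0),(2,3,0,1),(2,3,1,0),
   (3,0,1,2),(3,0,2,1),(3,1,0,2),(3,1,2,0),(3,2,0,1),(3,2,1,0)]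

/-- Disjointness of two closed runs given by the ranks of their ends. [folklore] -/
def dj (a b c d : ℕ) : Bool := Nat.blt (max a b) (min c d) || Nat.blt (max c d) (min a b)

/-- **Validity on ranks** `r₀,…,r₇` of the columns `X_1,…,X_8` (`X_8 = X_0`): the bottom row is
read eastwards (`r₇ < r₀`) and the three closed runs on each of the lines `y = 1`, `y = 2` are
pairwise disjoint (moves `k = 0,…,7` run from `X_k` to `X_{k+1}`; shape `A`: line `1` carries the
moves `1, 5, 7`, line `2` the moves `2, 4, 6`; shape `B`: `1, 3, 7` and `2, 4, 6`).
[cite: Rechnitzer2006Haruspicy2, Lemma 21] -/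
def valid8 (isA : Bool) (r0 r1 r2 r3 r4 r5 r6 r7 : ℕ) : Bool :=
  Nat.blt r7 r0 &&
  (if isA then
    dj r0 r1 r4 r5 && dj r0 r1 r6 r7 && dj r4 r5 r6 r7 && dj r1 r2 r3 r4 && dj r1 r2 r5 r6 && dj r3 r4 r5 r6
   else
    dj r0 r1 r2 r3 && dj r0 r1 r6 r7 && dj r2 r3 r6 r7 && dj r1 r2 r3 r4 && dj r1 r2 r5 r6 && dj r3 r4 r5 r6)

/-- `valid8` on a rank vector. [folklore] -/
def pdisj (isA : Bool) : List ℕ → Bool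
  | [r0, r1, r2, r3, r4, r5, r6, r7] => valid8 isA r0 r1 r2 r3 r4 r5 r6 r7
  | _ => false

/-- The candidate rank vectors of a shape over an event sequence that pass `valid8`: the two
bottom-row letters at the two `B`-events (west end first), the two top-row letters at the two
`T`-events in either order, the four middle-row letters at the four `M`-events in any order.
[cite: Rechnitzer2006Haruspicy2, Lemma 21] -/
def candRanks (isA : Bool) (E : List ℕ) : List (List ℕ) :=
  let bs := idxs 0 E 0
  let ms := idxs 1 E 0
  let ts := idxs 2 E 0
  let b0 := bs.getD 0 0
  let b1 := bs.getD 1 0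
  let t0 := ts.getD 0 0
  let t1 := ts.getD 1 0
  ([(t0, t1), (t1, t0)]).flatMap fun tt => perms4.filterMap fun σ =>
    let m0 := ms.getD σ.1 0
    let m1 := ms.getD σ.2.1 0
    let m2 := ms.getD σ.2.2.1 0
    let m3 := ms.getD σ.2.2.2 0
    if isA then
      (if valid8 true b1 m0 tt.1 tt.2 m1 m2 m3 b0 then some [b1, m0, tt.1, tt.2, m1, m2, m3, b0] else none)
    else
      (if valid8 false b1 m0 m1 m2 tt.1 tt.2 m3 b0 then some [b1, m0, m1, m2, tt.1, tt.2, m3, b0] else none)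

/-- The row tag (`0` = `B`, `1` = `M`, `2` = `T`) of the vertical letter ending move `j`
(in column `X_{j+1}`). [cite: Rechnitzer2006Haruspicy2, Lemma 21] -/
def ptTag (isA : Bool) (j : ℕ) : ℕ :=
  if isA then ([0, 1, 2, 2, 1, 1, 1, 0] : List ℕ).getD j 0 else ([0, 1, 1, 1, 2, 2, 1, 0] : List ℕ).getD j 0

/-- **Consistency of a labelled pattern**: eight ranks below the number of events, each vertical
letter at an event carrying its row, and conversely every event a genuine code `1…7` all of whose
rows are attained by some vertical letter. [cite: Rechnitzer2006Haruspicy2, Lemma 21] -/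
def pconsistent (isA : Bool) (E : List ℕ) (r : List ℕ) : Bool :=
  (r.length == 8) &&
  (List.range 8).all (fun j => Nat.blt (r.getD j 0) E.length && hasTag (ptTag isA j) (E.getD (r.getD j 0) 0)) &&
  (List.range E.length).all (fun i =>
    Nat.blt 0 (E.getD i 0) && Nat.blt (E.getD i 0) 8 &&
    (List.range 3).all (fun tag => !hasTag tag (E.getD i 0) ||
      (List.range 8).any (fun j => ptTag isA j == tag && r.getD j 0 == i)))

/-- A labelled pattern: shape, event sequence, ranks of the eight vertical letters.
[cite: Rechnitzer2006Haruspicy2, Lemma 21] -/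
structure LPat where
  /-- shape `A` (`NNNSSNSS`) or `B` (`NNSNNSSS`) -/
  isA : Bool
  /-- the events of the distinct columns, from the left -/
  E : List ℕ
  /-- the ranks of the columns `X_1, …, X_8` -/
  r : List ℕ
deriving DecidableEq, Repr

/-- The valid labelled patterns of a shape whose leftmost event is `e`. [cite: Rechnitzer2006Haruspicy2, Lemma 21] -/
def validPatsChunk (isA : Bool) (e : ℕ) : List LPat :=
  (seqsChunk e).flatMap fun E => ((candRanks isA E).filter (pconsistent isA E)).map fun r => ⟨isA, E, r⟩

/-- **The valid labelled patterns** (`540` of them, `validPats_eq`). [cite: Rechnitzer2006Haruspicy2, Lemma 21] -/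
def validPats : List LPat :=
  (List.range 7).flatMap fun i => validPatsChunk true (i + 1) ++ validPatsChunk false (i + 1)

/-- The rank of the start of move `k` (`X_0 = X_8` is the letter `7`, `X_k` the letter `k - 1`).
[folklore] -/
def rk (r : List ℕ) (k : ℕ) : ℕ := if k = 0 ∨ k = 8 then r.getD 7 0 else r.getD (k - 1) 0

/-- Move `k` covers the gap `i` (between the columns of ranks `i` and `i + 1`). [folklore] -/
def covers (r : List ℕ) (k i : ℕ) : Bool :=
  Nat.ble (min (rk r k) (rk r (k + 1))) i && Nat.blt i (max (rk r k) (rk r (k + 1)))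

/-- The number of moves covering the gap `i` (twice the number of cells of the polygon over it).
[folklore] -/
def cov (r : List ℕ) (i : ℕ) : ℕ := ((List.range 8).filter fun k => covers r k i).length

/-- The index of the top move. [cite: Rechnitzer2006Haruspicy2, Lemma 21] -/
def topIdx (isA : Bool) : ℕ := if isA then 3 else 5

/-- The exponent of `t` contributed by a unit of the gap `i` (`1` under the top row). [folklore] -/
def wa (P : LPat) (i : ℕ) : ℕ := if covers P.r (topIdx P.isA) i then 1 else 0

/-- The exponent of `s` contributed by a unit of the gap `i` (`1` under the bottom row). [folklore] -/
def wb (P : LPat) (i : ℕ) : ℕ := if covers P.r 0 i then 1 else 0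

/-- The exponent of `x` contributed by a unit of the gap `i`: half the coverage minus the top-row
indicator (the half-perimeter minus the top row). [folklore] -/
def we (P : LPat) (i : ℕ) : ℕ := cov P.r i / 2 - wa P i

/-- The number of gaps of a pattern. [folklore] -/
def ngaps (P : LPat) : ℕ := P.E.length - 1

/-- The heights of the eight runs, as naturals. [cite: Rechnitzer2006Haruspicy2, Lemma 21] -/
def bbHtN (isA : Bool) (k : ℕ) : ℕ :=
  if isA then ([0, 1, 2, 3, 2, 1, 2, 1] : List ℕ).getD k 0 else ([0, 1, 2, 1, 2, 3, 2, 1] : List ℕ).getD k 0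

/-- Disjointness of the closed runs of ANY two moves at the same height (a consequence of `valid8`,
checked on the data). [cite: Rechnitzer2006Haruspicy2, Lemma 21] -/
def pdisjAll (P : LPat) : Bool :=
  (List.range 8).all fun k => (List.range 8).all fun k' =>
    !(Nat.blt k k' && (bbHtN P.isA k == bbHtN P.isA k')) || dj (rk P.r k) (rk P.r (k + 1)) (rk P.r k') (rk P.r (k' + 1))

/-- Coverage bookkeeping (checked on the data): every gap is covered by a positive even number of
moves, at least twice the top-row indicator. [folklore] -/
def pgood (P : LPat) : Bool :=
  (List.range (P.E.length - 1)).all fun i =>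
    (cov P.r i % 2 == 0) && Nat.ble 2 (cov P.r i) && Nat.ble (2 * wa P i) (cov P.r i)

/-- A numeric code of a labelled pattern (used only to test for duplicates cheaply). [folklore] -/
def codeOf (P : LPat) : ℕ :=
  (P.r ++ P.E ++ [P.E.length, if P.isA then 1 else 0]).foldl (fun acc d => acc * 16 + d) 0

/-- The valid labelled patterns of shape `A` whose leftmost column carries the
event `1` (data; certified by `validPatsChunk_true_1`). [cite: Rechnitzer2006Haruspicy2, Lemma 21] -/
def vpData_true_1 : List LPat :=
  [{ isA := true, E := [1, 2, 2, 2, 1, 4, 2, 4], r := [4, 6, 7, 5, 3, 2, 1, 0] },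
   { isA := true, E := [1, 2, 2, 2, 1, 4, 4, 2], r := [4, 7, 6, 5, 3, 2, 1, 0] },
   { isA := true, E := [1, 2, 2, 2, 1, 4, 6], r := [4, 6, 6, 5, 3, 2, 1, 0] },
   { isA := true, E := [1, 2, 2, 2, 4, 1, 2, 4], r := [5, 6, 7, 4, 3, 2, 1, 0] },
   { isA := true, E := [1, 2, 2, 2, 4, 1, 4, 2], r := [5, 7, 6, 4, 3, 2, 1, 0] },
   { isA := true, E := [1, 2, 2, 2, 4, 1, 6], r := [5, 6, 6, 4, 3, 2, 1, 0] },
   { isA := true, E := [1, 2, 2, 2, 4, 2, 1, 4], r := [6, 5, 7, 4, 3, 2, 1, 0] },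
   { isA := true, E := [1, 2, 2, 2, 4, 2, 4, 1], r := [7, 5, 6, 4, 3, 2, 1, 0] },
   { isA := true, E := [1, 2, 2, 2, 4, 2, 5], r := [6, 5, 6, 4, 3, 2, 1, 0] },
   { isA := true, E := [1, 2, 2, 2, 4, 3, 4], r := [5, 5, 6, 4, 3, 2, 1, 0] },
   { isA := true, E := [1, 2, 2, 2, 4, 4, 1, 2], r := [6, 7, 5, 4, 3, 2, 1, 0] },
   { isA := true, E := [1, 2, 2, 2, 4, 4, 2, 1], r := [7, 6, 5, 4, 3, 2, 1, 0] },
   { isA := true, E := [1, 2, 2, 2, 4, 4, 3], r := [6, 6, 5, 4, 3, 2, 1, 0] },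
   { isA := true, E := [1, 2, 2, 2, 4, 5, 2], r := [5, 6, 5, 4, 3, 2, 1, 0] },
   { isA := true, E := [1, 2, 2, 2, 4, 6, 1], r := [6, 5, 5, 4, 3, 2, 1, 0] },
   { isA := true, E := [1, 2, 2, 2, 4, 7], r := [5, 5, 5, 4, 3, 2, 1, 0] },
   { isA := true, E := [1, 2, 2, 2, 5, 2, 4], r := [4, 5, 6, 4, 3, 2, 1, 0] },
   { isA := true, E := [1, 2, 2, 2, 5, 4, 2], r := [4, 6, 5, 4, 3, 2, 1, 0] },
   { isA := true, E := [1, 2, 2, 2, 5, 6], r := [4, 5, 5, 4, 3, 2, 1, 0] },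
   { isA := true, E := [1, 2, 2, 4, 2, 1, 2, 4], r := [5, 6, 7, 3, 4, 2, 1, 0] },
   { isA := true, E := [1, 2, 2, 4, 2, 1, 4, 2], r := [5, 7, 6, 3, 4, 2, 1, 0] },
   { isA := true, E := [1, 2, 2, 4, 2, 1, 6], r := [5, 6, 6, 3, 4, 2, 1, 0] },
   { isA := true, E := [1, 2, 2, 4, 2, 2, 1, 4], r := [6, 5, 7, 3, 4, 2, 1, 0] },
   { isA := true, E := [1, 2, 2, 4, 2, 2, 4, 1], r := [7, 5, 6, 3, 4, 2, 1, 0] },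
   { isA := true, E := [1, 2, 2, 4, 2, 2, 5], r := [6, 5, 6, 3, 4, 2, 1, 0] },
   { isA := true, E := [1, 2, 2, 4, 2, 3, 4], r := [5, 5, 6, 3, 4, 2, 1, 0] },
   { isA := true, E := [1, 2, 2, 4, 2, 4, 1, 2], r := [6, 7, 5, 3, 4, 2, 1, 0] },
   { isA := true, E := [1, 2, 2, 4, 2, 4, 2, 1], r := [7, 6, 5, 3, 4, 2, 1, 0] },
   { isA := true, E := [1, 2, 2, 4, 2, 4, 3], r := [6, 6, 5, 3, 4, 2, 1, 0] },
   { isA := true, E := [1, 2, 2, 4, 2, 5, 2], r := [5, 6, 5, 3, 4, 2, 1, 0] },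
   { isA := true, E := [1, 2, 2, 4, 2, 6, 1], r := [6, 5, 5, 3, 4, 2, 1, 0] },
   { isA := true, E := [1, 2, 2, 4, 2, 7], r := [5, 5, 5, 3, 4, 2, 1, 0] },
   { isA := true, E := [1, 2, 2, 6, 1, 2, 4], r := [4, 5, 6, 3, 3, 2, 1, 0] },
   { isA := true, E := [1, 2, 2, 6, 1, 4, 2], r := [4, 6, 5, 3, 3, 2, 1, 0] },
   { isA := true, E := [1, 2, 2, 6, 1, 6], r := [4, 5, 5, 3, 3, 2, 1, 0] },
   { isA := true, E := [1, 2, 2, 6, 2, 1, 4], r := [5, 4, 6, 3, 3, 2, 1, 0] },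
   { isA := true, E := [1, 2, 2, 6, 2, 4, 1], r := [6, 4, 5, 3, 3, 2, 1, 0] },
   { isA := true, E := [1, 2, 2, 6, 2, 5], r := [5, 4, 5, 3, 3, 2, 1, 0] },
   { isA := true, E := [1, 2, 2, 6, 3, 4], r := [4, 4, 5, 3, 3, 2, 1, 0] },
   { isA := true, E := [1, 2, 2, 6, 4, 1, 2], r := [5, 6, 4, 3, 3, 2, 1, 0] },
   { isA := true, E := [1, 2, 2, 6, 4, 2, 1], r := [6, 5, 4, 3, 3, 2, 1, 0] },
   { isA := true, E := [1, 2, 2, 6, 4, 3], r := [5, 5, 4, 3, 3, 2, 1, 0] },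
   { isA := true, E := [1, 2, 2, 6, 5, 2], r := [4, 5, 4, 3, 3, 2, 1, 0] },
   { isA := true, E := [1, 2, 2, 6, 6, 1], r := [5, 4, 4, 3, 3, 2, 1, 0] },
   { isA := true, E := [1, 2, 2, 6, 7], r := [4, 4, 4, 3, 3, 2, 1, 0] }]

/-- The valid labelled patterns of shape `B` whose leftmost column carries the
event `1` (data; certified by `validPatsChunk_false_1`). [cite: Rechnitzer2006Haruspicy2, Lemma 21] -/
def vpData_false_1 : List LPat :=
  [{ isA := false, E := [1, 2, 1, 4, 2, 2, 2, 4], r := [2, 4, 5, 6, 7, 3, 1, 0] },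
   { isA := false, E := [1, 2, 1, 4, 2, 2, 4, 2], r := [2, 4, 5, 7, 6, 3, 1, 0] },
   { isA := false, E := [1, 2, 1, 4, 2, 2, 6], r := [2, 4, 5, 6, 6, 3, 1, 0] },
   { isA := false, E := [1, 2, 4, 1, 2, 2, 2, 4], r := [3, 4, 5, 6, 7, 2, 1, 0] },
   { isA := false, E := [1, 2, 4, 1, 2, 2, 4, 2], r := [3, 4, 5, 7, 6, 2, 1, 0] },
   { isA := false, E := [1, 2, 4, 1, 2, 2, 6], r := [3, 4, 5, 6, 6, 2, 1, 0] },
   { isA := false, E := [1, 2, 4, 2, 1, 2, 2, 4], r := [4, 3, 5, 6, 7, 2, 1, 0] },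
   { isA := false, E := [1, 2, 4, 2, 1, 2, 4, 2], r := [4, 3, 5, 7, 6, 2, 1, 0] },
   { isA := false, E := [1, 2, 4, 2, 1, 2, 6], r := [4, 3, 5, 6, 6, 2, 1, 0] },
   { isA := false, E := [1, 2, 4, 2, 4, 2, 1, 2], r := [6, 7, 5, 3, 4, 2, 1, 0] },
   { isA := false, E := [1, 2, 4, 2, 4, 2, 2, 1], r := [7, 6, 5, 3, 4, 2, 1, 0] },
   { isA := false, E := [1, 2, 4, 2, 4, 2, 3], r := [6, 6, 5, 3, 4, 2, 1, 0] },
   { isA := false, E := [1, 2, 4, 3, 2, 2, 4], r := [3, 3, 4, 5, 6, 2, 1, 0] },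
   { isA := false, E := [1, 2, 4, 3, 2, 4, 2], r := [3, 3, 4, 6, 5, 2, 1, 0] },
   { isA := false, E := [1, 2, 4, 3, 2, 6], r := [3, 3, 4, 5, 5, 2, 1, 0] },
   { isA := false, E := [1, 2, 4, 4, 2, 2, 1, 2], r := [6, 7, 5, 4, 3, 2, 1, 0] },
   { isA := false, E := [1, 2, 4, 4, 2, 2, 2, 1], r := [7, 6, 5, 4, 3, 2, 1, 0] },
   { isA := false, E := [1, 2, 4, 4, 2, 2, 3], r := [6, 6, 5, 4, 3, 2, 1, 0] },
   { isA := false, E := [1, 2, 4, 6, 2, 1, 2], r := [5, 6, 4, 3, 3, 2, 1, 0] },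
   { isA := false, E := [1, 2, 4, 6, 2, 2, 1], r := [6, 5, 4, 3, 3, 2, 1, 0] },
   { isA := false, E := [1, 2, 4, 6, 2, 3], r := [5, 5, 4, 3, 3, 2, 1, 0] },
   { isA := false, E := [1, 2, 5, 2, 2, 2, 4], r := [2, 3, 4, 5, 6, 2, 1, 0] },
   { isA := false, E := [1, 2, 5, 2, 2, 4, 2], r := [2, 3, 4, 6, 5, 2, 1, 0] },
   { isA := false, E := [1, 2, 5, 2, 2, 6], r := [2, 3, 4, 5, 5, 2, 1, 0] },
   { isA := false, E := [1, 4, 2, 1, 2, 2, 2, 4], r := [3, 4, 5, 6, 7, 1, 2, 0] },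
   { isA := false, E := [1, 4, 2, 1, 2, 2, 4, 2], r := [3, 4, 5, 7, 6, 1, 2, 0] },
   { isA := false, E := [1, 4, 2, 1, 2, 2, 6], r := [3, 4, 5, 6, 6, 1, 2, 0] },
   { isA := false, E := [1, 4, 2, 2, 1, 2, 2, 4], r := [4, 3, 5, 6, 7, 1, 2, 0] },
   { isA := false, E := [1, 4, 2, 2, 1, 2, 4, 2], r := [4, 3, 5, 7, 6, 1, 2, 0] },
   { isA := false, E := [1, 4, 2, 2, 1, 2, 6], r := [4, 3, 5, 6, 6, 1, 2, 0] },
   { isA := false, E := [1, 4, 2, 2, 4, 2, 1, 2], r := [6, 7, 5, 3, 4, 1, 2, 0] },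
   { isA := false, E := [1, 4, 2, 2, 4, 2, 2, 1], r := [7, 6, 5, 3, 4, 1, 2, 0] },
   { isA := false, E := [1, 4, 2, 2, 4, 2, 3], r := [6, 6, 5, 3, 4, 1, 2, 0] },
   { isA := false, E := [1, 4, 2, 3, 2, 2, 4], r := [3, 3, 4, 5, 6, 1, 2, 0] },
   { isA := false, E := [1, 4, 2, 3, 2, 4, 2], r := [3, 3, 4, 6, 5, 1, 2, 0] },
   { isA := false, E := [1, 4, 2, 3, 2, 6], r := [3, 3, 4, 5, 5, 1, 2, 0] },
   { isA := false, E := [1, 4, 2, 4, 2, 2, 1, 2], r := [6, 7, 5, 4, 3, 1, 2, 0] },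
   { isA := false, E := [1, 4, 2, 4, 2, 2, 2, 1], r := [7, 6, 5, 4, 3, 1, 2, 0] },
   { isA := false, E := [1, 4, 2, 4, 2, 2, 3], r := [6, 6, 5, 4, 3, 1, 2, 0] },
   { isA := false, E := [1, 4, 2, 6, 2, 1, 2], r := [5, 6, 4, 3, 3, 1, 2, 0] },
   { isA := false, E := [1, 4, 2, 6, 2, 2, 1], r := [6, 5, 4, 3, 3, 1, 2, 0] },
   { isA := false, E := [1, 4, 2, 6, 2, 3], r := [5, 5, 4, 3, 3, 1, 2, 0] },
   { isA := false, E := [1, 6, 1, 2, 2, 2, 4], r := [2, 3, 4, 5, 6, 1, 1, 0] },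
   { isA := false, E := [1, 6, 1, 2, 2, 4, 2], r := [2, 3, 4, 6, 5, 1, 1, 0] },
   { isA := false, E := [1, 6, 1, 2, 2, 6], r := [2, 3, 4, 5, 5, 1, 1, 0] },
   { isA := false, E := [1, 6, 2, 1, 2, 2, 4], r := [3, 2, 4, 5, 6, 1, 1, 0] },
   { isA := false, E := [1, 6, 2, 1, 2, 4, 2], r := [3, 2, 4, 6, 5, 1, 1, 0] },
   { isA := false, E := [1, 6, 2, 1, 2, 6], r := [3, 2, 4, 5, 5, 1, 1, 0] },
   { isA := false, E := [1, 6, 2, 4, 2, 1, 2], r := [5, 6, 4, 2, 3, 1, 1, 0] },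
   { isA := false, E := [1, 6, 2, 4, 2, 2, 1], r := [6, 5, 4, 2, 3, 1, 1, 0] },
   { isA := false, E := [1, 6, 2, 4, 2, 3], r := [5, 5, 4, 2, 3, 1, 1, 0] },
   { isA := false, E := [1, 6, 3, 2, 2, 4], r := [2, 2, 3, 4, 5, 1, 1, 0] },
   { isA := false, E := [1, 6, 3, 2, 4, 2], r := [2, 2, 3, 5, 4, 1, 1, 0] },
   { isA := false, E := [1, 6, 3, 2, 6], r := [2, 2, 3, 4, 4, 1, 1, 0] },
   { isA := false, E := [1, 6, 4, 2, 2, 1, 2], r := [5, 6, 4, 3, 2, 1, 1, 0] },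
   { isA := false, E := [1, 6, 4, 2, 2, 2, 1], r := [6, 5, 4, 3, 2, 1, 1, 0] },
   { isA := false, E := [1, 6, 4, 2, 2, 3], r := [5, 5, 4, 3, 2, 1, 1, 0] },
   { isA := false, E := [1, 6, 6, 2, 1, 2], r := [4, 5, 3, 2, 2, 1, 1, 0] },
   { isA := false, E := [1, 6, 6, 2, 2, 1], r := [5, 4, 3, 2, 2, 1, 1, 0] },
   { isA := false, E := [1, 6, 6, 2, 3], r := [4, 4, 3, 2, 2, 1, 1, 0] }]

/-- The valid labelled patterns of shape `A` whose leftmost column carries the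
event `2` (data; certified by `validPatsChunk_true_2`). [cite: Rechnitzer2006Haruspicy2, Lemma 21] -/
def vpData_true_2 : List LPat :=
  [{ isA := true, E := [2, 1, 2, 2, 1, 4, 2, 4], r := [4, 6, 7, 5, 3, 2, 0, 1] },
   { isA := true, E := [2, 1, 2, 2, 1, 4, 4, 2], r := [4, 7, 6, 5, 3, 2, 0, 1] },
   { isA := true, E := [2, 1, 2, 2, 1, 4, 6], r := [4, 6, 6, 5, 3, 2, 0, 1] },
   { isA := true, E := [2, 1, 2, 2, 4, 1, 2, 4], r := [5, 6, 7, 4, 3, 2, 0, 1] },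
   { isA := true, E := [2, 1, 2, 2, 4, 1, 4, 2], r := [5, 7, 6, 4, 3, 2, 0, 1] },
   { isA := true, E := [2, 1, 2, 2, 4, 1, 6], r := [5, 6, 6, 4, 3, 2, 0, 1] },
   { isA := true, E := [2, 1, 2, 2, 4, 2, 1, 4], r := [6, 5, 7, 4, 3, 2, 0, 1] },
   { isA := true, E := [2, 1, 2, 2, 4, 2, 4, 1], r := [7, 5, 6, 4, 3, 2, 0, 1] },
   { isA := true, E := [2, 1, 2, 2, 4, 2, 5], r := [6, 5, 6, 4, 3, 2, 0, 1] },
   { isA := true, E := [2, 1, 2, 2, 4, 3, 4], r := [5, 5, 6, 4, 3, 2, 0, 1] },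
   { isA := true, E := [2, 1, 2, 2, 4, 4, 1, 2], r := [6, 7, 5, 4, 3, 2, 0, 1] },
   { isA := true, E := [2, 1, 2, 2, 4, 4, 2, 1], r := [7, 6, 5, 4, 3, 2, 0, 1] },
   { isA := true, E := [2, 1, 2, 2, 4, 4, 3], r := [6, 6, 5, 4, 3, 2, 0, 1] },
   { isA := true, E := [2, 1, 2, 2, 4, 5, 2], r := [5, 6, 5, 4, 3, 2, 0, 1] },
   { isA := true, E := [2, 1, 2, 2, 4, 6, 1], r := [6, 5, 5, 4, 3, 2, 0, 1] },
   { isA := true, E := [2, 1, 2, 2, 4, 7], r := [5, 5, 5, 4, 3, 2, 0, 1] },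
   { isA := true, E := [2, 1, 2, 2, 5, 2, 4], r := [4, 5, 6, 4, 3, 2, 0, 1] },
   { isA := true, E := [2, 1, 2, 2, 5, 4, 2], r := [4, 6, 5, 4, 3, 2, 0, 1] },
   { isA := true, E := [2, 1, 2, 2, 5, 6], r := [4, 5, 5, 4, 3, 2, 0, 1] },
   { isA := true, E := [2, 1, 2, 4, 2, 1, 2, 4], r := [5, 6, 7, 3, 4, 2, 0, 1] },
   { isA := true, E := [2, 1, 2, 4, 2, 1, 4, 2], r := [5, 7, 6, 3, 4, 2, 0, 1] },
   { isA := true, E := [2, 1, 2, 4, 2, 1, 6], r := [5, 6, 6, 3, 4, 2, 0, 1] },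
   { isA := true, E := [2, 1, 2, 4, 2, 2, 1, 4], r := [6, 5, 7, 3, 4, 2, 0, 1] },
   { isA := true, E := [2, 1, 2, 4, 2, 2, 4, 1], r := [7, 5, 6, 3, 4, 2, 0, 1] },
   { isA := true, E := [2, 1, 2, 4, 2, 2, 5], r := [6, 5, 6, 3, 4, 2, 0, 1] },
   { isA := true, E := [2, 1, 2, 4, 2, 3, 4], r := [5, 5, 6, 3, 4, 2, 0, 1] },
   { isA := true, E := [2, 1, 2, 4, 2, 4, 1, 2], r := [6, 7, 5, 3, 4, 2, 0, 1] },
   { isA := true, E := [2, 1, 2, 4, 2, 4, 2, 1], r := [7, 6, 5, 3, 4, 2, 0, 1] },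
   { isA := true, E := [2, 1, 2, 4, 2, 4, 3], r := [6, 6, 5, 3, 4, 2, 0, 1] },
   { isA := true, E := [2, 1, 2, 4, 2, 5, 2], r := [5, 6, 5, 3, 4, 2, 0, 1] },
   { isA := true, E := [2, 1, 2, 4, 2, 6, 1], r := [6, 5, 5, 3, 4, 2, 0, 1] },
   { isA := true, E := [2, 1, 2, 4, 2, 7], r := [5, 5, 5, 3, 4, 2, 0, 1] },
   { isA := true, E := [2, 1, 2, 6, 1, 2, 4], r := [4, 5, 6, 3, 3, 2, 0, 1] },
   { isA := true, E := [2, 1, 2, 6, 1, 4, 2], r := [4, 6, 5, 3, 3, 2, 0, 1] },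
   { isA := true, E := [2, 1, 2, 6, 1, 6], r := [4, 5, 5, 3, 3, 2, 0, 1] },
   { isA := true, E := [2, 1, 2, 6, 2, 1, 4], r := [5, 4, 6, 3, 3, 2, 0, 1] },
   { isA := true, E := [2, 1, 2, 6, 2, 4, 1], r := [6, 4, 5, 3, 3, 2, 0, 1] },
   { isA := true, E := [2, 1, 2, 6, 2, 5], r := [5, 4, 5, 3, 3, 2, 0, 1] },
   { isA := true, E := [2, 1, 2, 6, 3, 4], r := [4, 4, 5, 3, 3, 2, 0, 1] },
   { isA := true, E := [2, 1, 2, 6, 4, 1, 2], r := [5, 6, 4, 3, 3, 2, 0, 1] },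
   { isA := true, E := [2, 1, 2, 6, 4, 2, 1], r := [6, 5, 4, 3, 3, 2, 0, 1] },
   { isA := true, E := [2, 1, 2, 6, 4, 3], r := [5, 5, 4, 3, 3, 2, 0, 1] },
   { isA := true, E := [2, 1, 2, 6, 5, 2], r := [4, 5, 4, 3, 3, 2, 0, 1] },
   { isA := true, E := [2, 1, 2, 6, 6, 1], r := [5, 4, 4, 3, 3, 2, 0, 1] },
   { isA := true, E := [2, 1, 2, 6, 7], r := [4, 4, 4, 3, 3, 2, 0, 1] },
   { isA := true, E := [2, 4, 2, 1, 2, 1, 2, 4], r := [5, 6, 7, 1, 0, 2, 4, 3] },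
   { isA := true, E := [2, 4, 2, 1, 2, 1, 4, 2], r := [5, 7, 6, 1, 0, 2, 4, 3] },
   { isA := true, E := [2, 4, 2, 1, 2, 1, 6], r := [5, 6, 6, 1, 0, 2, 4, 3] },
   { isA := true, E := [2, 4, 2, 1, 2, 2, 1, 4], r := [6, 5, 7, 1, 0, 2, 4, 3] },
   { isA := true, E := [2, 4, 2, 1, 2, 2, 4, 1], r := [7, 5, 6, 1, 0, 2, 4, 3] },
   { isA := true, E := [2, 4, 2, 1, 2, 2, 5], r := [6, 5, 6, 1, 0, 2, 4, 3] },
   { isA := true, E := [2, 4, 2, 1, 2, 3, 4], r := [5, 5, 6, 1, 0, 2, 4, 3] },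
   { isA := true, E := [2, 4, 2, 1, 2, 4, 1, 2], r := [6, 7, 5, 1, 0, 2, 4, 3] },
   { isA := true, E := [2, 4, 2, 1, 2, 4, 2, 1], r := [7, 6, 5, 1, 0, 2, 4, 3] },
   { isA := true, E := [2, 4, 2, 1, 2, 4, 3], r := [6, 6, 5, 1, 0, 2, 4, 3] },
   { isA := true, E := [2, 4, 2, 1, 2, 5, 2], r := [5, 6, 5, 1, 0, 2, 4, 3] },
   { isA := true, E := [2, 4, 2, 1, 2, 6, 1], r := [6, 5, 5, 1, 0, 2, 4, 3] },
   { isA := true, E := [2, 4, 2, 1, 2, 7], r := [5, 5, 5, 1, 0, 2, 4, 3] },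
   { isA := true, E := [2, 4, 2, 2, 1, 1, 2, 4], r := [5, 6, 7, 1, 0, 2, 3, 4] },
   { isA := true, E := [2, 4, 2, 2, 1, 1, 4, 2], r := [5, 7, 6, 1, 0, 2, 3, 4] },
   { isA := true, E := [2, 4, 2, 2, 1, 1, 6], r := [5, 6, 6, 1, 0, 2, 3, 4] },
   { isA := true, E := [2, 4, 2, 2, 1, 2, 1, 4], r := [6, 5, 7, 1, 0, 2, 3, 4] },
   { isA := true, E := [2, 4, 2, 2, 1, 2, 4, 1], r := [7, 5, 6, 1, 0, 2, 3, 4] },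
   { isA := true, E := [2, 4, 2, 2, 1, 2, 5], r := [6, 5, 6, 1, 0, 2, 3, 4] },
   { isA := true, E := [2, 4, 2, 2, 1, 3, 4], r := [5, 5, 6, 1, 0, 2, 3, 4] },
   { isA := true, E := [2, 4, 2, 2, 1, 4, 1, 2], r := [6, 7, 5, 1, 0, 2, 3, 4] },
   { isA := true, E := [2, 4, 2, 2, 1, 4, 2, 1], r := [7, 6, 5, 1, 0, 2, 3, 4] },
   { isA := true, E := [2, 4, 2, 2, 1, 4, 3], r := [6, 6, 5, 1, 0, 2, 3, 4] },
   { isA := true, E := [2, 4, 2, 2, 1, 5, 2], r := [5, 6, 5, 1, 0, 2, 3, 4] },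
   { isA := true, E := [2, 4, 2, 2, 1, 6, 1], r := [6, 5, 5, 1, 0, 2, 3, 4] },
   { isA := true, E := [2, 4, 2, 2, 1, 7], r := [5, 5, 5, 1, 0, 2, 3, 4] },
   { isA := true, E := [2, 4, 2, 2, 4, 1, 1, 2], r := [6, 7, 4, 1, 0, 2, 3, 5] },
   { isA := true, E := [2, 4, 2, 2, 4, 1, 2, 1], r := [7, 6, 4, 1, 0, 2, 3, 5] },
   { isA := true, E := [2, 4, 2, 2, 4, 1, 3], r := [6, 6, 4, 1, 0, 2, 3, 5] },
   { isA := true, E := [2, 4, 2, 2, 5, 1, 2], r := [5, 6, 4, 1, 0, 2, 3, 4] },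
   { isA := true, E := [2, 4, 2, 2, 5, 2, 1], r := [6, 5, 4, 1, 0, 2, 3, 4] },
   { isA := true, E := [2, 4, 2, 2, 5, 3], r := [5, 5, 4, 1, 0, 2, 3, 4] },
   { isA := true, E := [2, 4, 2, 3, 1, 2, 4], r := [4, 5, 6, 1, 0, 2, 3, 3] },
   { isA := true, E := [2, 4, 2, 3, 1, 4, 2], r := [4, 6, 5, 1, 0, 2, 3, 3] },
   { isA := true, E := [2, 4, 2, 3, 1, 6], r := [4, 5, 5, 1, 0, 2, 3, 3] },
   { isA := true, E := [2, 4, 2, 3, 2, 1, 4], r := [5, 4, 6, 1, 0, 2, 3, 3] },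
   { isA := true, E := [2, 4, 2, 3, 2, 4, 1], r := [6, 4, 5, 1, 0, 2, 3, 3] },
   { isA := true, E := [2, 4, 2, 3, 2, 5], r := [5, 4, 5, 1, 0, 2, 3, 3] },
   { isA := true, E := [2, 4, 2, 3, 3, 4], r := [4, 4, 5, 1, 0, 2, 3, 3] },
   { isA := true, E := [2, 4, 2, 3, 4, 1, 2], r := [5, 6, 4, 1, 0, 2, 3, 3] },
   { isA := true, E := [2, 4, 2, 3, 4, 2, 1], r := [6, 5, 4, 1, 0, 2, 3, 3] },
   { isA := true, E := [2, 4, 2, 3, 4, 3], r := [5, 5, 4, 1, 0, 2, 3, 3] },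
   { isA := true, E := [2, 4, 2, 3, 5, 2], r := [4, 5, 4, 1, 0, 2, 3, 3] },
   { isA := true, E := [2, 4, 2, 3, 6, 1], r := [5, 4, 4, 1, 0, 2, 3, 3] },
   { isA := true, E := [2, 4, 2, 3, 7], r := [4, 4, 4, 1, 0, 2, 3, 3] }]

/-- The valid labelled patterns of shape `B` whose leftmost column carries the
event `2` (data; certified by `validPatsChunk_false_2`). [cite: Rechnitzer2006Haruspicy2, Lemma 21] -/
def vpData_false_2 : List LPat :=
  [{ isA := false, E := [2, 1, 1, 4, 2, 2, 2, 4], r := [2, 4, 5, 6, 7, 3, 0, 1] },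
   { isA := false, E := [2, 1, 1, 4, 2, 2, 4, 2], r := [2, 4, 5, 7, 6, 3, 0, 1] },
   { isA := false, E := [2, 1, 1, 4, 2, 2, 6], r := [2, 4, 5, 6, 6, 3, 0, 1] },
   { isA := false, E := [2, 1, 4, 1, 2, 2, 2, 4], r := [3, 4, 5, 6, 7, 2, 0, 1] },
   { isA := false, E := [2, 1, 4, 1, 2, 2, 4, 2], r := [3, 4, 5, 7, 6, 2, 0, 1] },
   { isA := false, E := [2, 1, 4, 1, 2, 2, 6], r := [3, 4, 5, 6, 6, 2, 0, 1] },
   { isA := false, E := [2, 1, 4, 2, 1, 2, 2, 4], r := [4, 3, 5, 6, 7, 2, 0, 1] },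
   { isA := false, E := [2, 1, 4, 2, 1, 2, 4, 2], r := [4, 3, 5, 7, 6, 2, 0, 1] },
   { isA := false, E := [2, 1, 4, 2, 1, 2, 6], r := [4, 3, 5, 6, 6, 2, 0, 1] },
   { isA := false, E := [2, 1, 4, 2, 4, 2, 1, 2], r := [6, 7, 5, 3, 4, 2, 0, 1] },
   { isA := false, E := [2, 1, 4, 2, 4, 2, 2, 1], r := [7, 6, 5, 3, 4, 2, 0, 1] },
   { isA := false, E := [2, 1, 4, 2, 4, 2, 3], r := [6, 6, 5, 3, 4, 2, 0, 1] },
   { isA := false, E := [2, 1, 4, 3, 2, 2, 4], r := [3, 3, 4, 5, 6, 2, 0, 1] },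
   { isA := false, E := [2, 1, 4, 3, 2, 4, 2], r := [3, 3, 4, 6, 5, 2, 0, 1] },
   { isA := false, E := [2, 1, 4, 3, 2, 6], r := [3, 3, 4, 5, 5, 2, 0, 1] },
   { isA := false, E := [2, 1, 4, 4, 2, 2, 1, 2], r := [6, 7, 5, 4, 3, 2, 0, 1] },
   { isA := false, E := [2, 1, 4, 4, 2, 2, 2, 1], r := [7, 6, 5, 4, 3, 2, 0, 1] },
   { isA := false, E := [2, 1, 4, 4, 2, 2, 3], r := [6, 6, 5, 4, 3, 2, 0, 1] },
   { isA := false, E := [2, 1, 4, 6, 2, 1, 2], r := [5, 6, 4, 3, 3, 2, 0, 1] },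
   { isA := false, E := [2, 1, 4, 6, 2, 2, 1], r := [6, 5, 4, 3, 3, 2, 0, 1] },
   { isA := false, E := [2, 1, 4, 6, 2, 3], r := [5, 5, 4, 3, 3, 2, 0, 1] },
   { isA := false, E := [2, 1, 5, 2, 2, 2, 4], r := [2, 3, 4, 5, 6, 2, 0, 1] },
   { isA := false, E := [2, 1, 5, 2, 2, 4, 2], r := [2, 3, 4, 6, 5, 2, 0, 1] },
   { isA := false, E := [2, 1, 5, 2, 2, 6], r := [2, 3, 4, 5, 5, 2, 0, 1] },
   { isA := false, E := [2, 4, 1, 1, 2, 2, 2, 4], r := [3, 4, 5, 6, 7, 1, 0, 2] },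
   { isA := false, E := [2, 4, 1, 1, 2, 2, 4, 2], r := [3, 4, 5, 7, 6, 1, 0, 2] },
   { isA := false, E := [2, 4, 1, 1, 2, 2, 6], r := [3, 4, 5, 6, 6, 1, 0, 2] },
   { isA := false, E := [2, 4, 1, 2, 1, 2, 2, 4], r := [4, 3, 5, 6, 7, 1, 0, 2] },
   { isA := false, E := [2, 4, 1, 2, 1, 2, 4, 2], r := [4, 3, 5, 7, 6, 1, 0, 2] },
   { isA := false, E := [2, 4, 1, 2, 1, 2, 6], r := [4, 3, 5, 6, 6, 1, 0, 2] },
   { isA := false, E := [2, 4, 1, 2, 4, 2, 1, 2], r := [6, 7, 5, 3, 4, 1, 0, 2] },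
   { isA := false, E := [2, 4, 1, 2, 4, 2, 2, 1], r := [7, 6, 5, 3, 4, 1, 0, 2] },
   { isA := false, E := [2, 4, 1, 2, 4, 2, 3], r := [6, 6, 5, 3, 4, 1, 0, 2] },
   { isA := false, E := [2, 4, 1, 3, 2, 2, 4], r := [3, 3, 4, 5, 6, 1, 0, 2] },
   { isA := false, E := [2, 4, 1, 3, 2, 4, 2], r := [3, 3, 4, 6, 5, 1, 0, 2] },
   { isA := false, E := [2, 4, 1, 3, 2, 6], r := [3, 3, 4, 5, 5, 1, 0, 2] },
   { isA := false, E := [2, 4, 1, 4, 2, 2, 1, 2], r := [6, 7, 5, 4, 3, 1, 0, 2] },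
   { isA := false, E := [2, 4, 1, 4, 2, 2, 2, 1], r := [7, 6, 5, 4, 3, 1, 0, 2] },
   { isA := false, E := [2, 4, 1, 4, 2, 2, 3], r := [6, 6, 5, 4, 3, 1, 0, 2] },
   { isA := false, E := [2, 4, 1, 6, 2, 1, 2], r := [5, 6, 4, 3, 3, 1, 0, 2] },
   { isA := false, E := [2, 4, 1, 6, 2, 2, 1], r := [6, 5, 4, 3, 3, 1, 0, 2] },
   { isA := false, E := [2, 4, 1, 6, 2, 3], r := [5, 5, 4, 3, 3, 1, 0, 2] },
   { isA := false, E := [2, 4, 4, 1, 2, 2, 1, 2], r := [6, 7, 5, 4, 2, 1, 0, 3] },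
   { isA := false, E := [2, 4, 4, 1, 2, 2, 2, 1], r := [7, 6, 5, 4, 2, 1, 0, 3] },
   { isA := false, E := [2, 4, 4, 1, 2, 2, 3], r := [6, 6, 5, 4, 2, 1, 0, 3] },
   { isA := false, E := [2, 4, 5, 2, 2, 1, 2], r := [5, 6, 4, 3, 2, 1, 0, 2] },
   { isA := false, E := [2, 4, 5, 2, 2, 2, 1], r := [6, 5, 4, 3, 2, 1, 0, 2] },
   { isA := false, E := [2, 4, 5, 2, 2, 3], r := [5, 5, 4, 3, 2, 1, 0, 2] },
   { isA := false, E := [2, 5, 1, 2, 2, 2, 4], r := [2, 3, 4, 5, 6, 1, 0, 1] },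
   { isA := false, E := [2, 5, 1, 2, 2, 4, 2], r := [2, 3, 4, 6, 5, 1, 0, 1] },
   { isA := false, E := [2, 5, 1, 2, 2, 6], r := [2, 3, 4, 5, 5, 1, 0, 1] },
   { isA := false, E := [2, 5, 2, 1, 2, 2, 4], r := [3, 2, 4, 5, 6, 1, 0, 1] },
   { isA := false, E := [2, 5, 2, 1, 2, 4, 2], r := [3, 2, 4, 6, 5, 1, 0, 1] },
   { isA := false, E := [2, 5, 2, 1, 2, 6], r := [3, 2, 4, 5, 5, 1, 0, 1] },
   { isA := false, E := [2, 5, 2, 4, 2, 1, 2], r := [5, 6, 4, 2, 3, 1, 0, 1] },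
   { isA := false, E := [2, 5, 2, 4, 2, 2, 1], r := [6, 5, 4, 2, 3, 1, 0, 1] },
   { isA := false, E := [2, 5, 2, 4, 2, 3], r := [5, 5, 4, 2, 3, 1, 0, 1] },
   { isA := false, E := [2, 5, 3, 2, 2, 4], r := [2, 2, 3, 4, 5, 1, 0, 1] },
   { isA := false, E := [2, 5, 3, 2, 4, 2], r := [2, 2, 3, 5, 4, 1, 0, 1] },
   { isA := false, E := [2, 5, 3, 2, 6], r := [2, 2, 3, 4, 4, 1, 0, 1] },
   { isA := false, E := [2, 5, 4, 2, 2, 1, 2], r := [5, 6, 4, 3, 2, 1, 0, 1] },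
   { isA := false, E := [2, 5, 4, 2, 2, 2, 1], r := [6, 5, 4, 3, 2, 1, 0, 1] },
   { isA := false, E := [2, 5, 4, 2, 2, 3], r := [5, 5, 4, 3, 2, 1, 0, 1] },
   { isA := false, E := [2, 5, 6, 2, 1, 2], r := [4, 5, 3, 2, 2, 1, 0, 1] },
   { isA := false, E := [2, 5, 6, 2, 2, 1], r := [5, 4, 3, 2, 2, 1, 0, 1] },
   { isA := false, E := [2, 5, 6, 2, 3], r := [4, 4, 3, 2, 2, 1, 0, 1] }]

/-- The valid labelled patterns of shape `A` whose leftmost column carries the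
event `3` (data; certified by `validPatsChunk_true_3`). [cite: Rechnitzer2006Haruspicy2, Lemma 21] -/
def vpData_true_3 : List LPat :=
  [{ isA := true, E := [3, 2, 2, 1, 4, 2, 4], r := [3, 5, 6, 4, 2, 1, 0, 0] },
   { isA := true, E := [3, 2, 2, 1, 4, 4, 2], r := [3, 6, 5, 4, 2, 1, 0, 0] },
   { isA := true, E := [3, 2, 2, 1, 4, 6], r := [3, 5, 5, 4, 2, 1, 0, 0] },
   { isA := true, E := [3, 2, 2, 4, 1, 2, 4], r := [4, 5, 6, 3, 2, 1, 0, 0] },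
   { isA := true, E := [3, 2, 2, 4, 1, 4, 2], r := [4, 6, 5, 3, 2, 1, 0, 0] },
   { isA := true, E := [3, 2, 2, 4, 1, 6], r := [4, 5, 5, 3, 2, 1, 0, 0] },
   { isA := true, E := [3, 2, 2, 4, 2, 1, 4], r := [5, 4, 6, 3, 2, 1, 0, 0] },
   { isA := true, E := [3, 2, 2, 4, 2, 4, 1], r := [6, 4, 5, 3, 2, 1, 0, 0] },
   { isA := true, E := [3, 2, 2, 4, 2, 5], r := [5, 4, 5, 3, 2, 1, 0, 0] },
   { isA := true, E := [3, 2, 2, 4, 3, 4], r := [4, 4, 5, 3, 2, 1, 0, 0] },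
   { isA := true, E := [3, 2, 2, 4, 4, 1, 2], r := [5, 6, 4, 3, 2, 1, 0, 0] },
   { isA := true, E := [3, 2, 2, 4, 4, 2, 1], r := [6, 5, 4, 3, 2, 1, 0, 0] },
   { isA := true, E := [3, 2, 2, 4, 4, 3], r := [5, 5, 4, 3, 2, 1, 0, 0] },
   { isA := true, E := [3, 2, 2, 4, 5, 2], r := [4, 5, 4, 3, 2, 1, 0, 0] },
   { isA := true, E := [3, 2, 2, 4, 6, 1], r := [5, 4, 4, 3, 2, 1, 0, 0] },
   { isA := true, E := [3, 2, 2, 4, 7], r := [4, 4, 4, 3, 2, 1, 0, 0] },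
   { isA := true, E := [3, 2, 2, 5, 2, 4], r := [3, 4, 5, 3, 2, 1, 0, 0] },
   { isA := true, E := [3, 2, 2, 5, 4, 2], r := [3, 5, 4, 3, 2, 1, 0, 0] },
   { isA := true, E := [3, 2, 2, 5, 6], r := [3, 4, 4, 3, 2, 1, 0, 0] },
   { isA := true, E := [3, 2, 4, 2, 1, 2, 4], r := [4, 5, 6, 2, 3, 1, 0, 0] },
   { isA := true, E := [3, 2, 4, 2, 1, 4, 2], r := [4, 6, 5, 2, 3, 1, 0, 0] },
   { isA := true, E := [3, 2, 4, 2, 1, 6], r := [4, 5, 5, 2, 3, 1, 0, 0] },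
   { isA := true, E := [3, 2, 4, 2, 2, 1, 4], r := [5, 4, 6, 2, 3, 1, 0, 0] },
   { isA := true, E := [3, 2, 4, 2, 2, 4, 1], r := [6, 4, 5, 2, 3, 1, 0, 0] },
   { isA := true, E := [3, 2, 4, 2, 2, 5], r := [5, 4, 5, 2, 3, 1, 0, 0] },
   { isA := true, E := [3, 2, 4, 2, 3, 4], r := [4, 4, 5, 2, 3, 1, 0, 0] },
   { isA := true, E := [3, 2, 4, 2, 4, 1, 2], r := [5, 6, 4, 2, 3, 1, 0, 0] },
   { isA := true, E := [3, 2, 4, 2, 4, 2, 1], r := [6, 5, 4, 2, 3, 1, 0, 0] },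
   { isA := true, E := [3, 2, 4, 2, 4, 3], r := [5, 5, 4, 2, 3, 1, 0, 0] },
   { isA := true, E := [3, 2, 4, 2, 5, 2], r := [4, 5, 4, 2, 3, 1, 0, 0] },
   { isA := true, E := [3, 2, 4, 2, 6, 1], r := [5, 4, 4, 2, 3, 1, 0, 0] },
   { isA := true, E := [3, 2, 4, 2, 7], r := [4, 4, 4, 2, 3, 1, 0, 0] },
   { isA := true, E := [3, 2, 6, 1, 2, 4], r := [3, 4, 5, 2, 2, 1, 0, 0] },
   { isA := true, E := [3, 2, 6, 1, 4, 2], r := [3, 5, 4, 2, 2, 1, 0, 0] },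
   { isA := true, E := [3, 2, 6, 1, 6], r := [3, 4, 4, 2, 2, 1, 0, 0] },
   { isA := true, E := [3, 2, 6, 2, 1, 4], r := [4, 3, 5, 2, 2, 1, 0, 0] },
   { isA := true, E := [3, 2, 6, 2, 4, 1], r := [5, 3, 4, 2, 2, 1, 0, 0] },
   { isA := true, E := [3, 2, 6, 2, 5], r := [4, 3, 4, 2, 2, 1, 0, 0] },
   { isA := true, E := [3, 2, 6, 3, 4], r := [3, 3, 4, 2, 2, 1, 0, 0] },
   { isA := true, E := [3, 2, 6, 4, 1, 2], r := [4, 5, 3, 2, 2, 1, 0, 0] },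
   { isA := true, E := [3, 2, 6, 4, 2, 1], r := [5, 4, 3, 2, 2, 1, 0, 0] },
   { isA := true, E := [3, 2, 6, 4, 3], r := [4, 4, 3, 2, 2, 1, 0, 0] },
   { isA := true, E := [3, 2, 6, 5, 2], r := [3, 4, 3, 2, 2, 1, 0, 0] },
   { isA := true, E := [3, 2, 6, 6, 1], r := [4, 3, 3, 2, 2, 1, 0, 0] },
   { isA := true, E := [3, 2, 6, 7], r := [3, 3, 3, 2, 2, 1, 0, 0] }]

/-- The valid labelled patterns of shape `B` whose leftmost column carries the
event `3` (data; certified by `validPatsChunk_false_3`). [cite: Rechnitzer2006Haruspicy2, Lemma 21] -/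
def vpData_false_3 : List LPat :=
  [{ isA := false, E := [3, 1, 4, 2, 2, 2, 4], r := [1, 3, 4, 5, 6, 2, 0, 0] },
   { isA := false, E := [3, 1, 4, 2, 2, 4, 2], r := [1, 3, 4, 6, 5, 2, 0, 0] },
   { isA := false, E := [3, 1, 4, 2, 2, 6], r := [1, 3, 4, 5, 5, 2, 0, 0] },
   { isA := false, E := [3, 4, 1, 2, 2, 2, 4], r := [2, 3, 4, 5, 6, 1, 0, 0] },
   { isA := false, E := [3, 4, 1, 2, 2, 4, 2], r := [2, 3, 4, 6, 5, 1, 0, 0] },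
   { isA := false, E := [3, 4, 1, 2, 2, 6], r := [2, 3, 4, 5, 5, 1, 0, 0] },
   { isA := false, E := [3, 4, 2, 1, 2, 2, 4], r := [3, 2, 4, 5, 6, 1, 0, 0] },
   { isA := false, E := [3, 4, 2, 1, 2, 4, 2], r := [3, 2, 4, 6, 5, 1, 0, 0] },
   { isA := false, E := [3, 4, 2, 1, 2, 6], r := [3, 2, 4, 5, 5, 1, 0, 0] },
   { isA := false, E := [3, 4, 2, 4, 2, 1, 2], r := [5, 6, 4, 2, 3, 1, 0, 0] },
   { isA := false, E := [3, 4, 2, 4, 2, 2, 1], r := [6, 5, 4, 2, 3, 1, 0, 0] },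
   { isA := false, E := [3, 4, 2, 4, 2, 3], r := [5, 5, 4, 2, 3, 1, 0, 0] },
   { isA := false, E := [3, 4, 3, 2, 2, 4], r := [2, 2, 3, 4, 5, 1, 0, 0] },
   { isA := false, E := [3, 4, 3, 2, 4, 2], r := [2, 2, 3, 5, 4, 1, 0, 0] },
   { isA := false, E := [3, 4, 3, 2, 6], r := [2, 2, 3, 4, 4, 1, 0, 0] },
   { isA := false, E := [3, 4, 4, 2, 2, 1, 2], r := [5, 6, 4, 3, 2, 1, 0, 0] },
   { isA := false, E := [3, 4, 4, 2, 2, 2, 1], r := [6, 5, 4, 3, 2, 1, 0, 0] },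
   { isA := false, E := [3, 4, 4, 2, 2, 3], r := [5, 5, 4, 3, 2, 1, 0, 0] },
   { isA := false, E := [3, 4, 6, 2, 1, 2], r := [4, 5, 3, 2, 2, 1, 0, 0] },
   { isA := false, E := [3, 4, 6, 2, 2, 1], r := [5, 4, 3, 2, 2, 1, 0, 0] },
   { isA := false, E := [3, 4, 6, 2, 3], r := [4, 4, 3, 2, 2, 1, 0, 0] },
   { isA := false, E := [3, 5, 2, 2, 2, 4], r := [1, 2, 3, 4, 5, 1, 0, 0] },
   { isA := false, E := [3, 5, 2, 2, 4, 2], r := [1, 2, 3, 5, 4, 1, 0, 0] },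
   { isA := false, E := [3, 5, 2, 2, 6], r := [1, 2, 3, 4, 4, 1, 0, 0] }]

/-- The valid labelled patterns of shape `A` whose leftmost column carries the
event `4` (data; certified by `validPatsChunk_true_4`). [cite: Rechnitzer2006Haruspicy2, Lemma 21] -/
def vpData_true_4 : List LPat :=
  [{ isA := true, E := [4, 2, 2, 1, 2, 1, 2, 4], r := [5, 6, 7, 0, 1, 2, 4, 3] },
   { isA := true, E := [4, 2, 2, 1, 2, 1, 4, 2], r := [5, 7, 6, 0, 1, 2, 4, 3] },
   { isA := true, E := [4, 2, 2, 1, 2, 1, 6], r := [5, 6, 6, 0, 1, 2, 4, 3] },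
   { isA := true, E := [4, 2, 2, 1, 2, 2, 1, 4], r := [6, 5, 7, 0, 1, 2, 4, 3] },
   { isA := true, E := [4, 2, 2, 1, 2, 2, 4, 1], r := [7, 5, 6, 0, 1, 2, 4, 3] },
   { isA := true, E := [4, 2, 2, 1, 2, 2, 5], r := [6, 5, 6, 0, 1, 2, 4, 3] },
   { isA := true, E := [4, 2, 2, 1, 2, 3, 4], r := [5, 5, 6, 0, 1, 2, 4, 3] },
   { isA := true, E := [4, 2, 2, 1, 2, 4, 1, 2], r := [6, 7, 5, 0, 1, 2, 4, 3] },
   { isA := true, E := [4, 2, 2, 1, 2, 4, 2, 1], r := [7, 6, 5, 0, 1, 2, 4, 3] },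
   { isA := true, E := [4, 2, 2, 1, 2, 4, 3], r := [6, 6, 5, 0, 1, 2, 4, 3] },
   { isA := true, E := [4, 2, 2, 1, 2, 5, 2], r := [5, 6, 5, 0, 1, 2, 4, 3] },
   { isA := true, E := [4, 2, 2, 1, 2, 6, 1], r := [6, 5, 5, 0, 1, 2, 4, 3] },
   { isA := true, E := [4, 2, 2, 1, 2, 7], r := [5, 5, 5, 0, 1, 2, 4, 3] },
   { isA := true, E := [4, 2, 2, 2, 1, 1, 2, 4], r := [5, 6, 7, 0, 1, 2, 3, 4] },
   { isA := true, E := [4, 2, 2, 2, 1, 1, 4, 2], r := [5, 7, 6, 0, 1, 2, 3, 4] },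
   { isA := true, E := [4, 2, 2, 2, 1, 1, 6], r := [5, 6, 6, 0, 1, 2, 3, 4] },
   { isA := true, E := [4, 2, 2, 2, 1, 2, 1, 4], r := [6, 5, 7, 0, 1, 2, 3, 4] },
   { isA := true, E := [4, 2, 2, 2, 1, 2, 4, 1], r := [7, 5, 6, 0, 1, 2, 3, 4] },
   { isA := true, E := [4, 2, 2, 2, 1, 2, 5], r := [6, 5, 6, 0, 1, 2, 3, 4] },
   { isA := true, E := [4, 2, 2, 2, 1, 3, 4], r := [5, 5, 6, 0, 1, 2, 3, 4] },
   { isA := true, E := [4, 2, 2, 2, 1, 4, 1, 2], r := [6, 7, 5, 0, 1, 2, 3, 4] },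
   { isA := true, E := [4, 2, 2, 2, 1, 4, 2, 1], r := [7, 6, 5, 0, 1, 2, 3, 4] },
   { isA := true, E := [4, 2, 2, 2, 1, 4, 3], r := [6, 6, 5, 0, 1, 2, 3, 4] },
   { isA := true, E := [4, 2, 2, 2, 1, 5, 2], r := [5, 6, 5, 0, 1, 2, 3, 4] },
   { isA := true, E := [4, 2, 2, 2, 1, 6, 1], r := [6, 5, 5, 0, 1, 2, 3, 4] },
   { isA := true, E := [4, 2, 2, 2, 1, 7], r := [5, 5, 5, 0, 1, 2, 3, 4] },
   { isA := true, E := [4, 2, 2, 2, 4, 1, 1, 2], r := [6, 7, 4, 0, 1, 2, 3, 5] },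
   { isA := true, E := [4, 2, 2, 2, 4, 1, 2, 1], r := [7, 6, 4, 0, 1, 2, 3, 5] },
   { isA := true, E := [4, 2, 2, 2, 4, 1, 3], r := [6, 6, 4, 0, 1, 2, 3, 5] },
   { isA := true, E := [4, 2, 2, 2, 5, 1, 2], r := [5, 6, 4, 0, 1, 2, 3, 4] },
   { isA := true, E := [4, 2, 2, 2, 5, 2, 1], r := [6, 5, 4, 0, 1, 2, 3, 4] },
   { isA := true, E := [4, 2, 2, 2, 5, 3], r := [5, 5, 4, 0, 1, 2, 3, 4] },
   { isA := true, E := [4, 2, 2, 3, 1, 2, 4], r := [4, 5, 6, 0, 1, 2, 3, 3] },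
   { isA := true, E := [4, 2, 2, 3, 1, 4, 2], r := [4, 6, 5, 0, 1, 2, 3, 3] },
   { isA := true, E := [4, 2, 2, 3, 1, 6], r := [4, 5, 5, 0, 1, 2, 3, 3] },
   { isA := true, E := [4, 2, 2, 3, 2, 1, 4], r := [5, 4, 6, 0, 1, 2, 3, 3] },
   { isA := true, E := [4, 2, 2, 3, 2, 4, 1], r := [6, 4, 5, 0, 1, 2, 3, 3] },
   { isA := true, E := [4, 2, 2, 3, 2, 5], r := [5, 4, 5, 0, 1, 2, 3, 3] },
   { isA := true, E := [4, 2, 2, 3, 3, 4], r := [4, 4, 5, 0, 1, 2, 3, 3] },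
   { isA := true, E := [4, 2, 2, 3, 4, 1, 2], r := [5, 6, 4, 0, 1, 2, 3, 3] },
   { isA := true, E := [4, 2, 2, 3, 4, 2, 1], r := [6, 5, 4, 0, 1, 2, 3, 3] },
   { isA := true, E := [4, 2, 2, 3, 4, 3], r := [5, 5, 4, 0, 1, 2, 3, 3] },
   { isA := true, E := [4, 2, 2, 3, 5, 2], r := [4, 5, 4, 0, 1, 2, 3, 3] },
   { isA := true, E := [4, 2, 2, 3, 6, 1], r := [5, 4, 4, 0, 1, 2, 3, 3] },
   { isA := true, E := [4, 2, 2, 3, 7], r := [4, 4, 4, 0, 1, 2, 3, 3] }]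

/-- The valid labelled patterns of shape `B` whose leftmost column carries the
event `4` (data; certified by `validPatsChunk_false_4`). [cite: Rechnitzer2006Haruspicy2, Lemma 21] -/
def vpData_false_4 : List LPat :=
  [{ isA := false, E := [4, 1, 2, 1, 2, 2, 2, 4], r := [3, 4, 5, 6, 7, 0, 2, 1] },
   { isA := false, E := [4, 1, 2, 1, 2, 2, 4, 2], r := [3, 4, 5, 7, 6, 0, 2, 1] },
   { isA := false, E := [4, 1, 2, 1, 2, 2, 6], r := [3, 4, 5, 6, 6, 0, 2, 1] },
   { isA := false, E := [4, 1, 2, 2, 1, 2, 2, 4], r := [4, 3, 5, 6, 7, 0, 2, 1] },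
   { isA := false, E := [4, 1, 2, 2, 1, 2, 4, 2], r := [4, 3, 5, 7, 6, 0, 2, 1] },
   { isA := false, E := [4, 1, 2, 2, 1, 2, 6], r := [4, 3, 5, 6, 6, 0, 2, 1] },
   { isA := false, E := [4, 1, 2, 2, 4, 2, 1, 2], r := [6, 7, 5, 3, 4, 0, 2, 1] },
   { isA := false, E := [4, 1, 2, 2, 4, 2, 2, 1], r := [7, 6, 5, 3, 4, 0, 2, 1] },
   { isA := false, E := [4, 1, 2, 2, 4, 2, 3], r := [6, 6, 5, 3, 4, 0, 2, 1] },
   { isA := false, E := [4, 1, 2, 3, 2, 2, 4], r := [3, 3, 4, 5, 6, 0, 2, 1] },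
   { isA := false, E := [4, 1, 2, 3, 2, 4, 2], r := [3, 3, 4, 6, 5, 0, 2, 1] },
   { isA := false, E := [4, 1, 2, 3, 2, 6], r := [3, 3, 4, 5, 5, 0, 2, 1] },
   { isA := false, E := [4, 1, 2, 4, 2, 2, 1, 2], r := [6, 7, 5, 4, 3, 0, 2, 1] },
   { isA := false, E := [4, 1, 2, 4, 2, 2, 2, 1], r := [7, 6, 5, 4, 3, 0, 2, 1] },
   { isA := false, E := [4, 1, 2, 4, 2, 2, 3], r := [6, 6, 5, 4, 3, 0, 2, 1] },
   { isA := false, E := [4, 1, 2, 6, 2, 1, 2], r := [5, 6, 4, 3, 3, 0, 2, 1] },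
   { isA := false, E := [4, 1, 2, 6, 2, 2, 1], r := [6, 5, 4, 3, 3, 0, 2, 1] },
   { isA := false, E := [4, 1, 2, 6, 2, 3], r := [5, 5, 4, 3, 3, 0, 2, 1] },
   { isA := false, E := [4, 2, 1, 1, 2, 2, 2, 4], r := [3, 4, 5, 6, 7, 0, 1, 2] },
   { isA := false, E := [4, 2, 1, 1, 2, 2, 4, 2], r := [3, 4, 5, 7, 6, 0, 1, 2] },
   { isA := false, E := [4, 2, 1, 1, 2, 2, 6], r := [3, 4, 5, 6, 6, 0, 1, 2] },
   { isA := false, E := [4, 2, 1, 2, 1, 2, 2, 4], r := [4, 3, 5, 6, 7, 0, 1, 2] },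
   { isA := false, E := [4, 2, 1, 2, 1, 2, 4, 2], r := [4, 3, 5, 7, 6, 0, 1, 2] },
   { isA := false, E := [4, 2, 1, 2, 1, 2, 6], r := [4, 3, 5, 6, 6, 0, 1, 2] },
   { isA := false, E := [4, 2, 1, 2, 4, 2, 1, 2], r := [6, 7, 5, 3, 4, 0, 1, 2] },
   { isA := false, E := [4, 2, 1, 2, 4, 2, 2, 1], r := [7, 6, 5, 3, 4, 0, 1, 2] },
   { isA := false, E := [4, 2, 1, 2, 4, 2, 3], r := [6, 6, 5, 3, 4, 0, 1, 2] },
   { isA := false, E := [4, 2, 1, 3, 2, 2, 4], r := [3, 3, 4, 5, 6, 0, 1, 2] },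
   { isA := false, E := [4, 2, 1, 3, 2, 4, 2], r := [3, 3, 4, 6, 5, 0, 1, 2] },
   { isA := false, E := [4, 2, 1, 3, 2, 6], r := [3, 3, 4, 5, 5, 0, 1, 2] },
   { isA := false, E := [4, 2, 1, 4, 2, 2, 1, 2], r := [6, 7, 5, 4, 3, 0, 1, 2] },
   { isA := false, E := [4, 2, 1, 4, 2, 2, 2, 1], r := [7, 6, 5, 4, 3, 0, 1, 2] },
   { isA := false, E := [4, 2, 1, 4, 2, 2, 3], r := [6, 6, 5, 4, 3, 0, 1, 2] },
   { isA := false, E := [4, 2, 1, 6, 2, 1, 2], r := [5, 6, 4, 3, 3, 0, 1, 2] },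
   { isA := false, E := [4, 2, 1, 6, 2, 2, 1], r := [6, 5, 4, 3, 3, 0, 1, 2] },
   { isA := false, E := [4, 2, 1, 6, 2, 3], r := [5, 5, 4, 3, 3, 0, 1, 2] },
   { isA := false, E := [4, 2, 4, 1, 2, 2, 1, 2], r := [6, 7, 5, 4, 2, 0, 1, 3] },
   { isA := false, E := [4, 2, 4, 1, 2, 2, 2, 1], r := [7, 6, 5, 4, 2, 0, 1, 3] },
   { isA := false, E := [4, 2, 4, 1, 2, 2, 3], r := [6, 6, 5, 4, 2, 0, 1, 3] },
   { isA := false, E := [4, 2, 5, 2, 2, 1, 2], r := [5, 6, 4, 3, 2, 0, 1, 2] },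
   { isA := false, E := [4, 2, 5, 2, 2, 2, 1], r := [6, 5, 4, 3, 2, 0, 1, 2] },
   { isA := false, E := [4, 2, 5, 2, 2, 3], r := [5, 5, 4, 3, 2, 0, 1, 2] },
   { isA := false, E := [4, 3, 1, 2, 2, 2, 4], r := [2, 3, 4, 5, 6, 0, 1, 1] },
   { isA := false, E := [4, 3, 1, 2, 2, 4, 2], r := [2, 3, 4, 6, 5, 0, 1, 1] },
   { isA := false, E := [4, 3, 1, 2, 2, 6], r := [2, 3, 4, 5, 5, 0, 1, 1] },
   { isA := false, E := [4, 3, 2, 1, 2, 2, 4], r := [3, 2, 4, 5, 6, 0, 1, 1] },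
   { isA := false, E := [4, 3, 2, 1, 2, 4, 2], r := [3, 2, 4, 6, 5, 0, 1, 1] },
   { isA := false, E := [4, 3, 2, 1, 2, 6], r := [3, 2, 4, 5, 5, 0, 1, 1] },
   { isA := false, E := [4, 3, 2, 4, 2, 1, 2], r := [5, 6, 4, 2, 3, 0, 1, 1] },
   { isA := false, E := [4, 3, 2, 4, 2, 2, 1], r := [6, 5, 4, 2, 3, 0, 1, 1] },
   { isA := false, E := [4, 3, 2, 4, 2, 3], r := [5, 5, 4, 2, 3, 0, 1, 1] },
   { isA := false, E := [4, 3, 3, 2, 2, 4], r := [2, 2, 3, 4, 5, 0, 1, 1] },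
   { isA := false, E := [4, 3, 3, 2, 4, 2], r := [2, 2, 3, 5, 4, 0, 1, 1] },
   { isA := false, E := [4, 3, 3, 2, 6], r := [2, 2, 3, 4, 4, 0, 1, 1] },
   { isA := false, E := [4, 3, 4, 2, 2, 1, 2], r := [5, 6, 4, 3, 2, 0, 1, 1] },
   { isA := false, E := [4, 3, 4, 2, 2, 2, 1], r := [6, 5, 4, 3, 2, 0, 1, 1] },
   { isA := false, E := [4, 3, 4, 2, 2, 3], r := [5, 5, 4, 3, 2, 0, 1, 1] },
   { isA := false, E := [4, 3, 6, 2, 1, 2], r := [4, 5, 3, 2, 2, 0, 1, 1] },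
   { isA := false, E := [4, 3, 6, 2, 2, 1], r := [5, 4, 3, 2, 2, 0, 1, 1] },
   { isA := false, E := [4, 3, 6, 2, 3], r := [4, 4, 3, 2, 2, 0, 1, 1] }]

/-- The valid labelled patterns of shape `A` whose leftmost column carries the
event `5` (data; certified by `validPatsChunk_true_5`). [cite: Rechnitzer2006Haruspicy2, Lemma 21] -/
def vpData_true_5 : List LPat :=
  []

/-- The valid labelled patterns of shape `B` whose leftmost column carries the
event `5` (data; certified by `validPatsChunk_false_5`). [cite: Rechnitzer2006Haruspicy2, Lemma 21] -/
def vpData_false_5 : List LPat :=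
  [{ isA := false, E := [5, 2, 1, 2, 2, 2, 4], r := [2, 3, 4, 5, 6, 0, 1, 0] },
   { isA := false, E := [5, 2, 1, 2, 2, 4, 2], r := [2, 3, 4, 6, 5, 0, 1, 0] },
   { isA := false, E := [5, 2, 1, 2, 2, 6], r := [2, 3, 4, 5, 5, 0, 1, 0] },
   { isA := false, E := [5, 2, 2, 1, 2, 2, 4], r := [3, 2, 4, 5, 6, 0, 1, 0] },
   { isA := false, E := [5, 2, 2, 1, 2, 4, 2], r := [3, 2, 4, 6, 5, 0, 1, 0] },
   { isA := false, E := [5, 2, 2, 1, 2, 6], r := [3, 2, 4, 5, 5, 0, 1, 0] },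
   { isA := false, E := [5, 2, 2, 4, 2, 1, 2], r := [5, 6, 4, 2, 3, 0, 1, 0] },
   { isA := false, E := [5, 2, 2, 4, 2, 2, 1], r := [6, 5, 4, 2, 3, 0, 1, 0] },
   { isA := false, E := [5, 2, 2, 4, 2, 3], r := [5, 5, 4, 2, 3, 0, 1, 0] },
   { isA := false, E := [5, 2, 3, 2, 2, 4], r := [2, 2, 3, 4, 5, 0, 1, 0] },
   { isA := false, E := [5, 2, 3, 2, 4, 2], r := [2, 2, 3, 5, 4, 0, 1, 0] },
   { isA := false, E := [5, 2, 3, 2, 6], r := [2, 2, 3, 4, 4, 0, 1, 0] },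
   { isA := false, E := [5, 2, 4, 2, 2, 1, 2], r := [5, 6, 4, 3, 2, 0, 1, 0] },
   { isA := false, E := [5, 2, 4, 2, 2, 2, 1], r := [6, 5, 4, 3, 2, 0, 1, 0] },
   { isA := false, E := [5, 2, 4, 2, 2, 3], r := [5, 5, 4, 3, 2, 0, 1, 0] },
   { isA := false, E := [5, 2, 6, 2, 1, 2], r := [4, 5, 3, 2, 2, 0, 1, 0] },
   { isA := false, E := [5, 2, 6, 2, 2, 1], r := [5, 4, 3, 2, 2, 0, 1, 0] },
   { isA := false, E := [5, 2, 6, 2, 3], r := [4, 4, 3, 2, 2, 0, 1, 0] }]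

/-- The valid labelled patterns of shape `A` whose leftmost column carries the
event `6` (data; certified by `validPatsChunk_true_6`). [cite: Rechnitzer2006Haruspicy2, Lemma 21] -/
def vpData_true_6 : List LPat :=
  [{ isA := true, E := [6, 2, 1, 2, 1, 2, 4], r := [4, 5, 6, 0, 0, 1, 3, 2] },
   { isA := true, E := [6, 2, 1, 2, 1, 4, 2], r := [4, 6, 5, 0, 0, 1, 3, 2] },
   { isA := true, E := [6, 2, 1, 2, 1, 6], r := [4, 5, 5, 0, 0, 1, 3, 2] },
   { isA := true, E := [6, 2, 1, 2, 2, 1, 4], r := [5, 4, 6, 0, 0, 1, 3, 2] },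
   { isA := true, E := [6, 2, 1, 2, 2, 4, 1], r := [6, 4, 5, 0, 0, 1, 3, 2] },
   { isA := true, E := [6, 2, 1, 2, 2, 5], r := [5, 4, 5, 0, 0, 1, 3, 2] },
   { isA := true, E := [6, 2, 1, 2, 3, 4], r := [4, 4, 5, 0, 0, 1, 3, 2] },
   { isA := true, E := [6, 2, 1, 2, 4, 1, 2], r := [5, 6, 4, 0, 0, 1, 3, 2] },
   { isA := true, E := [6, 2, 1, 2, 4, 2, 1], r := [6, 5, 4, 0, 0, 1, 3, 2] },
   { isA := true, E := [6, 2, 1, 2, 4, 3], r := [5, 5, 4, 0, 0, 1, 3, 2] },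
   { isA := true, E := [6, 2, 1, 2, 5, 2], r := [4, 5, 4, 0, 0, 1, 3, 2] },
   { isA := true, E := [6, 2, 1, 2, 6, 1], r := [5, 4, 4, 0, 0, 1, 3, 2] },
   { isA := true, E := [6, 2, 1, 2, 7], r := [4, 4, 4, 0, 0, 1, 3, 2] },
   { isA := true, E := [6, 2, 2, 1, 1, 2, 4], r := [4, 5, 6, 0, 0, 1, 2, 3] },
   { isA := true, E := [6, 2, 2, 1, 1, 4, 2], r := [4, 6, 5, 0, 0, 1, 2, 3] },
   { isA := true, E := [6, 2, 2, 1, 1, 6], r := [4, 5, 5, 0, 0, 1, 2, 3] },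
   { isA := true, E := [6, 2, 2, 1, 2, 1, 4], r := [5, 4, 6, 0, 0, 1, 2, 3] },
   { isA := true, E := [6, 2, 2, 1, 2, 4, 1], r := [6, 4, 5, 0, 0, 1, 2, 3] },
   { isA := true, E := [6, 2, 2, 1, 2, 5], r := [5, 4, 5, 0, 0, 1, 2, 3] },
   { isA := true, E := [6, 2, 2, 1, 3, 4], r := [4, 4, 5, 0, 0, 1, 2, 3] },
   { isA := true, E := [6, 2, 2, 1, 4, 1, 2], r := [5, 6, 4, 0, 0, 1, 2, 3] },
   { isA := true, E := [6, 2, 2, 1, 4, 2, 1], r := [6, 5, 4, 0, 0, 1, 2, 3] },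
   { isA := true, E := [6, 2, 2, 1, 4, 3], r := [5, 5, 4, 0, 0, 1, 2, 3] },
   { isA := true, E := [6, 2, 2, 1, 5, 2], r := [4, 5, 4, 0, 0, 1, 2, 3] },
   { isA := true, E := [6, 2, 2, 1, 6, 1], r := [5, 4, 4, 0, 0, 1, 2, 3] },
   { isA := true, E := [6, 2, 2, 1, 7], r := [4, 4, 4, 0, 0, 1, 2, 3] },
   { isA := true, E := [6, 2, 2, 4, 1, 1, 2], r := [5, 6, 3, 0, 0, 1, 2, 4] },
   { isA := true, E := [6, 2, 2, 4, 1, 2, 1], r := [6, 5, 3, 0, 0, 1, 2, 4] },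
   { isA := true, E := [6, 2, 2, 4, 1, 3], r := [5, 5, 3, 0, 0, 1, 2, 4] },
   { isA := true, E := [6, 2, 2, 5, 1, 2], r := [4, 5, 3, 0, 0, 1, 2, 3] },
   { isA := true, E := [6, 2, 2, 5, 2, 1], r := [5, 4, 3, 0, 0, 1, 2, 3] },
   { isA := true, E := [6, 2, 2, 5, 3], r := [4, 4, 3, 0, 0, 1, 2, 3] },
   { isA := true, E := [6, 2, 3, 1, 2, 4], r := [3, 4, 5, 0, 0, 1, 2, 2] },
   { isA := true, E := [6, 2, 3, 1, 4, 2], r := [3, 5, 4, 0, 0, 1, 2, 2] },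
   { isA := true, E := [6, 2, 3, 1, 6], r := [3, 4, 4, 0, 0, 1, 2, 2] },
   { isA := true, E := [6, 2, 3, 2, 1, 4], r := [4, 3, 5, 0, 0, 1, 2, 2] },
   { isA := true, E := [6, 2, 3, 2, 4, 1], r := [5, 3, 4, 0, 0, 1, 2, 2] },
   { isA := true, E := [6, 2, 3, 2, 5], r := [4, 3, 4, 0, 0, 1, 2, 2] },
   { isA := true, E := [6, 2, 3, 3, 4], r := [3, 3, 4, 0, 0, 1, 2, 2] },
   { isA := true, E := [6, 2, 3, 4, 1, 2], r := [4, 5, 3, 0, 0, 1, 2, 2] },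
   { isA := true, E := [6, 2, 3, 4, 2, 1], r := [5, 4, 3, 0, 0, 1, 2, 2] },
   { isA := true, E := [6, 2, 3, 4, 3], r := [4, 4, 3, 0, 0, 1, 2, 2] },
   { isA := true, E := [6, 2, 3, 5, 2], r := [3, 4, 3, 0, 0, 1, 2, 2] },
   { isA := true, E := [6, 2, 3, 6, 1], r := [4, 3, 3, 0, 0, 1, 2, 2] },
   { isA := true, E := [6, 2, 3, 7], r := [3, 3, 3, 0, 0, 1, 2, 2] }]

/-- The valid labelled patterns of shape `B` whose leftmost column carries the
event `6` (data; certified by `validPatsChunk_false_6`). [cite: Rechnitzer2006Haruspicy2, Lemma 21] -/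
def vpData_false_6 : List LPat :=
  [{ isA := false, E := [6, 1, 1, 2, 2, 2, 4], r := [2, 3, 4, 5, 6, 0, 0, 1] },
   { isA := false, E := [6, 1, 1, 2, 2, 4, 2], r := [2, 3, 4, 6, 5, 0, 0, 1] },
   { isA := false, E := [6, 1, 1, 2, 2, 6], r := [2, 3, 4, 5, 5, 0, 0, 1] },
   { isA := false, E := [6, 1, 2, 1, 2, 2, 4], r := [3, 2, 4, 5, 6, 0, 0, 1] },
   { isA := false, E := [6, 1, 2, 1, 2, 4, 2], r := [3, 2, 4, 6, 5, 0, 0, 1] },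
   { isA := false, E := [6, 1, 2, 1, 2, 6], r := [3, 2, 4, 5, 5, 0, 0, 1] },
   { isA := false, E := [6, 1, 2, 4, 2, 1, 2], r := [5, 6, 4, 2, 3, 0, 0, 1] },
   { isA := false, E := [6, 1, 2, 4, 2, 2, 1], r := [6, 5, 4, 2, 3, 0, 0, 1] },
   { isA := false, E := [6, 1, 2, 4, 2, 3], r := [5, 5, 4, 2, 3, 0, 0, 1] },
   { isA := false, E := [6, 1, 3, 2, 2, 4], r := [2, 2, 3, 4, 5, 0, 0, 1] },
   { isA := false, E := [6, 1, 3, 2, 4, 2], r := [2, 2, 3, 5, 4, 0, 0, 1] },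
   { isA := false, E := [6, 1, 3, 2, 6], r := [2, 2, 3, 4, 4, 0, 0, 1] },
   { isA := false, E := [6, 1, 4, 2, 2, 1, 2], r := [5, 6, 4, 3, 2, 0, 0, 1] },
   { isA := false, E := [6, 1, 4, 2, 2, 2, 1], r := [6, 5, 4, 3, 2, 0, 0, 1] },
   { isA := false, E := [6, 1, 4, 2, 2, 3], r := [5, 5, 4, 3, 2, 0, 0, 1] },
   { isA := false, E := [6, 1, 6, 2, 1, 2], r := [4, 5, 3, 2, 2, 0, 0, 1] },
   { isA := false, E := [6, 1, 6, 2, 2, 1], r := [5, 4, 3, 2, 2, 0, 0, 1] },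
   { isA := false, E := [6, 1, 6, 2, 3], r := [4, 4, 3, 2, 2, 0, 0, 1] },
   { isA := false, E := [6, 4, 1, 2, 2, 1, 2], r := [5, 6, 4, 3, 1, 0, 0, 2] },
   { isA := false, E := [6, 4, 1, 2, 2, 2, 1], r := [6, 5, 4, 3, 1, 0, 0, 2] },
   { isA := false, E := [6, 4, 1, 2, 2, 3], r := [5, 5, 4, 3, 1, 0, 0, 2] },
   { isA := false, E := [6, 5, 2, 2, 1, 2], r := [4, 5, 3, 2, 1, 0, 0, 1] },
   { isA := false, E := [6, 5, 2, 2, 2, 1], r := [5, 4, 3, 2, 1, 0, 0, 1] },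
   { isA := false, E := [6, 5, 2, 2, 3], r := [4, 4, 3, 2, 1, 0, 0, 1] }]

/-- The valid labelled patterns of shape `A` whose leftmost column carries the
event `7` (data; certified by `validPatsChunk_true_7`). [cite: Rechnitzer2006Haruspicy2, Lemma 21] -/
def vpData_true_7 : List LPat :=
  []

/-- The valid labelled patterns of shape `B` whose leftmost column carries the
event `7` (data; certified by `validPatsChunk_false_7`). [cite: Rechnitzer2006Haruspicy2, Lemma 21] -/
def vpData_false_7 : List LPat :=
  [{ isA := false, E := [7, 1, 2, 2, 2, 4], r := [1, 2, 3, 4, 5, 0, 0, 0] },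
   { isA := false, E := [7, 1, 2, 2, 4, 2], r := [1, 2, 3, 5, 4, 0, 0, 0] },
   { isA := false, E := [7, 1, 2, 2, 6], r := [1, 2, 3, 4, 4, 0, 0, 0] },
   { isA := false, E := [7, 2, 1, 2, 2, 4], r := [2, 1, 3, 4, 5, 0, 0, 0] },
   { isA := false, E := [7, 2, 1, 2, 4, 2], r := [2, 1, 3, 5, 4, 0, 0, 0] },
   { isA := false, E := [7, 2, 1, 2, 6], r := [2, 1, 3, 4, 4, 0, 0, 0] },
   { isA := false, E := [7, 2, 4, 2, 1, 2], r := [4, 5, 3, 1, 2, 0, 0, 0] },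
   { isA := false, E := [7, 2, 4, 2, 2, 1], r := [5, 4, 3, 1, 2, 0, 0, 0] },
   { isA := false, E := [7, 2, 4, 2, 3], r := [4, 4, 3, 1, 2, 0, 0, 0] },
   { isA := false, E := [7, 3, 2, 2, 4], r := [1, 1, 2, 3, 4, 0, 0, 0] },
   { isA := false, E := [7, 3, 2, 4, 2], r := [1, 1, 2, 4, 3, 0, 0, 0] },
   { isA := false, E := [7, 3, 2, 6], r := [1, 1, 2, 3, 3, 0, 0, 0] },
   { isA := false, E := [7, 4, 2, 2, 1, 2], r := [4, 5, 3, 2, 1, 0, 0, 0] },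
   { isA := false, E := [7, 4, 2, 2, 2, 1], r := [5, 4, 3, 2, 1, 0, 0, 0] },
   { isA := false, E := [7, 4, 2, 2, 3], r := [4, 4, 3, 2, 1, 0, 0, 0] },
   { isA := false, E := [7, 6, 2, 1, 2], r := [3, 4, 2, 1, 1, 0, 0, 0] },
   { isA := false, E := [7, 6, 2, 2, 1], r := [4, 3, 2, 1, 1, 0, 0, 0] },
   { isA := false, E := [7, 6, 2, 3], r := [3, 3, 2, 1, 1, 0, 0, 0] }]

set_option maxHeartbeats 0 in
/-- Kernel enumeration of the chunk (shape `A`, first event `1`).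
[cite: Rechnitzer2006Haruspicy2, Lemma 21] -/
theorem validPatsChunk_true_1 : validPatsChunk true 1 = vpData_true_1 := by
  decide +kernel

set_option maxHeartbeats 0 in
/-- Kernel enumeration of the chunk (shape `B`, first event `1`).
[cite: Rechnitzer2006Haruspicy2, Lemma 21] -/
theorem validPatsChunk_false_1 : validPatsChunk false 1 = vpData_false_1 := by
  decide +kernel

set_option maxHeartbeats 0 in
/-- Kernel enumeration of the chunk (shape `A`, first event `2`).
[cite: Rechnitzer2006Haruspicy2, Lemma 21] -/
theorem validPatsChunk_true_2 : validPatsChunk true 2 = vpData_true_2 := by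
  decide +kernel

set_option maxHeartbeats 0 in
/-- Kernel enumeration of the chunk (shape `B`, first event `2`).
[cite: Rechnitzer2006Haruspicy2, Lemma 21] -/
theorem validPatsChunk_false_2 : validPatsChunk false 2 = vpData_false_2 := by
  decide +kernel

set_option maxHeartbeats 0 in
/-- Kernel enumeration of the chunk (shape `A`, first event `3`).
[cite: Rechnitzer2006Haruspicy2, Lemma 21] -/
theorem validPatsChunk_true_3 : validPatsChunk true 3 = vpData_true_3 := by
  decide +kernel

set_option maxHeartbeats 0 in
/-- Kernel enumeration of the chunk (shape `B`, first event `3`).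
[cite: Rechnitzer2006Haruspicy2, Lemma 21] -/
theorem validPatsChunk_false_3 : validPatsChunk false 3 = vpData_false_3 := by
  decide +kernel

set_option maxHeartbeats 0 in
/-- Kernel enumeration of the chunk (shape `A`, first event `4`).
[cite: Rechnitzer2006Haruspicy2, Lemma 21] -/
theorem validPatsChunk_true_4 : validPatsChunk true 4 = vpData_true_4 := by
  decide +kernel

set_option maxHeartbeats 0 in
/-- Kernel enumeration of the chunk (shape `B`, first event `4`).
[cite: Rechnitzer2006Haruspicy2, Lemma 21] -/
theorem validPatsChunk_false_4 : validPatsChunk false 4 = vpData_false_4 := by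
  decide +kernel

set_option maxHeartbeats 0 in
/-- Kernel enumeration of the chunk (shape `A`, first event `5`).
[cite: Rechnitzer2006Haruspicy2, Lemma 21] -/
theorem validPatsChunk_true_5 : validPatsChunk true 5 = vpData_true_5 := by
  decide +kernel

set_option maxHeartbeats 0 in
/-- Kernel enumeration of the chunk (shape `B`, first event `5`).
[cite: Rechnitzer2006Haruspicy2, Lemma 21] -/
theorem validPatsChunk_false_5 : validPatsChunk false 5 = vpData_false_5 := by
  decide +kernel

set_option maxHeartbeats 0 in
/-- Kernel enumeration of the chunk (shape `A`, first event `6`).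
[cite: Rechnitzer2006Haruspicy2, Lemma 21] -/
theorem validPatsChunk_true_6 : validPatsChunk true 6 = vpData_true_6 := by
  decide +kernel

set_option maxHeartbeats 0 in
/-- Kernel enumeration of the chunk (shape `B`, first event `6`).
[cite: Rechnitzer2006Haruspicy2, Lemma 21] -/
theorem validPatsChunk_false_6 : validPatsChunk false 6 = vpData_false_6 := by
  decide +kernel

set_option maxHeartbeats 0 in
/-- Kernel enumeration of the chunk (shape `A`, first event `7`).
[cite: Rechnitzer2006Haruspicy2, Lemma 21] -/
theorem validPatsChunk_true_7 : validPatsChunk true 7 = vpData_true_7 := by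
  decide +kernel

set_option maxHeartbeats 0 in
/-- Kernel enumeration of the chunk (shape `B`, first event `7`).
[cite: Rechnitzer2006Haruspicy2, Lemma 21] -/
theorem validPatsChunk_false_7 : validPatsChunk false 7 = vpData_false_7 := by
  decide +kernel

/-- The concatenated data. [cite: Rechnitzer2006Haruspicy2, Lemma 21] -/
def validPatsData : List LPat :=
  vpData_true_1 ++ (vpData_false_1 ++ (vpData_true_2 ++ (vpData_false_2 ++ (vpData_true_3 ++ (vpData_false_3 ++ (vpData_true_4 ++ (vpData_false_4 ++ (vpData_true_5 ++ (vpData_false_5 ++ (vpData_true_6 ++ (vpData_false_6 ++ (vpData_true_7 ++ vpData_false_7))))))))))))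

/-- `List.range 7`, spelled out. [folklore] -/
theorem range_seven : List.range 7 = [0, 1, 2, 3, 4, 5, 6] := by decide

/-- **`validPats` computed**: the fourteen chunks assembled. [cite: Rechnitzer2006Haruspicy2, Lemma 21] -/
theorem validPats_eq : validPats = validPatsData := by
  rw [validPats, range_seven]
  simp only [List.flatMap_cons, List.flatMap_nil, List.append_nil, zero_add, Nat.reduceAdd,
    validPatsChunk_true_1, validPatsChunk_false_1, validPatsChunk_true_2, validPatsChunk_false_2,
    validPatsChunk_true_3, validPatsChunk_false_3, validPatsChunk_true_4, validPatsChunk_false_4,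
    validPatsChunk_true_5, validPatsChunk_false_5, validPatsChunk_true_6, validPatsChunk_false_6,
    validPatsChunk_true_7, validPatsChunk_false_7, List.append_assoc, validPatsData]

/-- There are `540` valid labelled patterns. [cite: Rechnitzer2006Haruspicy2, Lemma 21] -/
theorem length_validPats : validPats.length = 540 := by
  rw [validPats_eq]; decide +kernel

/-- All same-height runs of a valid pattern are disjoint (data check). [cite: Rechnitzer2006Haruspicy2, Lemma 21] -/
theorem pdisjAll_of_mem {P : LPat} (h : P ∈ validPats) : pdisjAll P = true := by
  have key : validPatsData.all pdisjAll = true := by decide +kernel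
  rw [validPats_eq] at h
  exact List.all_eq_true.mp key P h

/-- The coverage bookkeeping holds for every valid pattern (data check). [folklore] -/
theorem pgood_of_mem {P : LPat} (h : P ∈ validPats) : pgood P = true := by
  have key : validPatsData.all pgood = true := by decide +kernel
  rw [validPats_eq] at h
  exact List.all_eq_true.mp key P h

/-- The valid patterns are pairwise distinct (data check on the codes). [folklore] -/
theorem nodup_validPats : validPats.Nodup := by
  have key : (validPatsData.map codeOf).Nodup := by decide +kernel
  rw [validPats_eq]
  exact key.of_map _

end Core

/-! ### Membership in the enumeration -/

section Membership

/-- The number of events carrying `tag`. [folklore] -/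
def tagCount (tag : ℕ) (E : List ℕ) : ℕ := (E.filter fun e => hasTag tag e).length

/-- `tagCount` of a cons. [folklore] -/
theorem tagCount_cons (tag e : ℕ) (E : List ℕ) :
    tagCount tag (e :: E) = (if hasTag tag e then 1 else 0) + tagCount tag E := by
  unfold tagCount; rw [List.filter_cons]; split_ifs <;> simp; omega

/-- Every event code `1…7` carries a row. [folklore] -/
theorem exists_hasTag {e : ℕ} (h1 : 1 ≤ e) (h7 : e ≤ 7) : hasTag 0 e = true ∨ hasTag 1 e = true ∨ hasTag 2 e = true := by
  interval_cases e <;> decide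

/-- **The generator is exhaustive**: a sequence of event codes `1…7` of length at most the fuel
lies in `seqs fuel` at its own row counts. [folklore] -/
theorem mem_seqs {E : List ℕ} (hE : ∀ e ∈ E, 1 ≤ e ∧ e ≤ 7) {fuel : ℕ} (hlen : E.length ≤ fuel) :
    E ∈ seqs fuel (tagCount 0 E) (tagCount 1 E) (tagCount 2 E) := by
  induction E generalizing fuel with
  | nil => cases fuel <;> simp [seqs, tagCount]
  | cons e E ih =>
    obtain ⟨f, rfl⟩ : ∃ f, fuel = f + 1 := ⟨fuel - 1, by simp at hlen; omega⟩
    obtain ⟨h1, h7⟩ := hE e (by simp)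
    have hE' : ∀ e ∈ E, 1 ≤ e ∧ e ≤ 7 := fun e' he' => hE e' (by simp [he'])
    have ih' := ih hE' (fuel := f) (by simp at hlen; omega)
    rw [seqs, tagCount_cons, tagCount_cons, tagCount_cons]
    have hne : ((if hasTag 0 e then 1 else 0) + tagCount 0 E == 0 &&
        ((if hasTag 1 e then 1 else 0) + tagCount 1 E == 0) &&
        ((if hasTag 2 e then 1 else 0) + tagCount 2 E == 0)) = false := by
      rcases exists_hasTag h1 h7 with h | h | h <;> simp [h]
    rw [hne]
    simp only [Bool.false_eq_true, ↓reduceIte, List.mem_flatMap, List.mem_range]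
    refine ⟨e - 1, by omega, ?_⟩
    rw [show e - 1 + 1 = e by omega]
    have hle : (Nat.ble (if hasTag 0 e then 1 else 0) ((if hasTag 0 e then 1 else 0) + tagCount 0 E) &&
        Nat.ble (if hasTag 1 e then 1 else 0) ((if hasTag 1 e then 1 else 0) + tagCount 1 E) &&
        Nat.ble (if hasTag 2 e then 1 else 0) ((if hasTag 2 e then 1 else 0) + tagCount 2 E)) = true := by
      simp [Nat.ble_eq]
    rw [if_pos hle, List.mem_map]
    exact ⟨E, by simpa using ih', rfl⟩

/-- Hence a sequence with a given first event and given row counts of the tail lies in the chunk of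
that event. [folklore] -/
theorem mem_seqsChunk {e : ℕ} {E : List ℕ} (hE : ∀ e' ∈ E, 1 ≤ e' ∧ e' ≤ 7) (hlen : E.length ≤ 7)
    (h0 : tagCount 0 E = 2 - (if hasTag 0 e then 1 else 0)) (h1 : tagCount 1 E = 4 - (if hasTag 1 e then 1 else 0))
    (h2 : tagCount 2 E = 2 - (if hasTag 2 e then 1 else 0)) : e :: E ∈ seqsChunk e := by
  rw [seqsChunk, List.mem_map]
  exact ⟨E, by rw [← h0, ← h1, ← h2]; exact mem_seqs hE hlen, rfl⟩

/-- Membership in `idxs`. [folklore] -/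
theorem mem_idxs {tag : ℕ} {E : List ℕ} {i k : ℕ} :
    k ∈ idxs tag E i ↔ i ≤ k ∧ k < i + E.length ∧ hasTag tag (E.getD (k - i) 0) = true := by
  induction E generalizing i with
  | nil => simp only [idxs, List.not_mem_nil, List.length_nil, false_iff]; omega
  | cons e E ih =>
    rw [idxs]
    have key : k ∈ idxs tag E (i + 1) ↔ i + 1 ≤ k ∧ k < i + (e :: E).length ∧ hasTag tag ((e :: E).getD (k - i) 0) = true := by
      rw [ih, List.length_cons]
      constructor
      · rintro ⟨h1, h2, h3⟩
        refine ⟨h1, by omega, ?_⟩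
        rw [show k - i = (k - (i + 1)) + 1 by omega]; simpa using h3
      · rintro ⟨h1, h2, h3⟩
        refine ⟨h1, by omega, ?_⟩
        rw [show k - i = (k - (i + 1)) + 1 by omega] at h3; simpa using h3
    split_ifs with h
    · rw [List.mem_cons, key]
      constructor
      · rintro (rfl | ⟨h1, h2, h3⟩)
        · exact ⟨le_rfl, by simp, by simpa using h⟩
        · exact ⟨by omega, h2, h3⟩
      · rintro ⟨h1, h2, h3⟩
        rcases h1.lt_or_eq with h1 | rfl
        · exact Or.inr ⟨h1, h2, h3⟩
        · exact Or.inl rfl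
    · rw [key]
      constructor
      · rintro ⟨h1, h2, h3⟩; exact ⟨by omega, h2, h3⟩
      · rintro ⟨h1, h2, h3⟩
        rcases h1.lt_or_eq with h1 | rfl
        · exact ⟨h1, h2, h3⟩
        · simp at h3; rw [h3] at h; exact absurd rfl h

/-- `idxs` is strictly increasing. [folklore] -/
theorem pairwise_idxs (tag : ℕ) (E : List ℕ) (i : ℕ) : (idxs tag E i).Pairwise (· < ·) := by
  induction E generalizing i with
  | nil => simp [idxs]
  | cons e E ih =>
    unfold idxs
    split_ifs
    · rw [List.pairwise_cons]
      exact ⟨fun k hk => (mem_idxs.mp hk).1, ih (i + 1)⟩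
    · exact ih (i + 1)

/-- `idxs` is determined by its members among strictly increasing lists. [folklore] -/
theorem idxs_eq_of_mem_iff {tag : ℕ} {E : List ℕ} {l : List ℕ} (hl : l.Pairwise (· < ·))
    (h : ∀ a, a ∈ idxs tag E 0 ↔ a ∈ l) : idxs tag E 0 = l :=
  (pairwise_idxs tag E 0).sortedLT.eq_of_mem_iff hl.sortedLT h

/-- Membership in `idxs _ _ 0`. [folklore] -/
theorem mem_idxs_zero {tag : ℕ} {E : List ℕ} {k : ℕ} :
    k ∈ idxs tag E 0 ↔ k < E.length ∧ hasTag tag (E.getD k 0) = true := by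
  rw [mem_idxs]; simp

/-- Four pairwise distinct indices below `4` form one of the `24` permutations. [folklore] -/
theorem mem_perms4 (a b c d : Fin 4) (h : a ≠ b ∧ a ≠ c ∧ a ≠ d ∧ b ≠ c ∧ b ≠ d ∧ c ≠ d) :
    ((a : ℕ), (b : ℕ), (c : ℕ), (d : ℕ)) ∈ perms4 := by
  revert a b c d
  decide +kernel

/-- Membership in `candRanks`, shape `A`. [cite: Rechnitzer2006Haruspicy2, Lemma 21] -/
theorem mem_candRanks_true {E : List ℕ} {r0 r1 r2 r3 r4 r5 r6 r7 : ℕ}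
    (hb : idxs 0 E 0 = [r7, r0]) (ht : idxs 2 E 0 = [r2, r3] ∨ idxs 2 E 0 = [r3, r2])
    (hm : ∃ σ ∈ perms4, (idxs 1 E 0).getD σ.1 0 = r1 ∧ (idxs 1 E 0).getD σ.2.1 0 = r4 ∧
      (idxs 1 E 0).getD σ.2.2.1 0 = r5 ∧ (idxs 1 E 0).getD σ.2.2.2 0 = r6)
    (hv : valid8 true r0 r1 r2 r3 r4 r5 r6 r7 = true) :
    [r0, r1, r2, r3, r4, r5, r6, r7] ∈ candRanks true E := by
  obtain ⟨σ, hσ, e1, e4, e5, e6⟩ := hm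
  rw [candRanks]
  simp only [hb, List.getD_cons_zero, List.getD_cons_succ, List.mem_flatMap, List.mem_cons,
    List.mem_filterMap, ↓reduceIte, List.not_mem_nil, or_false]
  rcases ht with ht | ht
  · refine ⟨(r2, r3), Or.inl (by rw [ht]; rfl), σ, hσ, ?_⟩
    rw [e1, e4, e5, e6, hv]; rfl
  · refine ⟨(r2, r3), Or.inr (by rw [ht]; rfl), σ, hσ, ?_⟩
    rw [e1, e4, e5, e6, hv]; rfl

/-- Membership in `candRanks`, shape `B`. [cite: Rechnitzer2006Haruspicy2, Lemma 21] -/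
theorem mem_candRanks_false {E : List ℕ} {r0 r1 r2 r3 r4 r5 r6 r7 : ℕ}
    (hb : idxs 0 E 0 = [r7, r0]) (ht : idxs 2 E 0 = [r4, r5] ∨ idxs 2 E 0 = [r5, r4])
    (hm : ∃ σ ∈ perms4, (idxs 1 E 0).getD σ.1 0 = r1 ∧ (idxs 1 E 0).getD σ.2.1 0 = r2 ∧
      (idxs 1 E 0).getD σ.2.2.1 0 = r3 ∧ (idxs 1 E 0).getD σ.2.2.2 0 = r6)
    (hv : valid8 false r0 r1 r2 r3 r4 r5 r6 r7 = true) :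
    [r0, r1, r2, r3, r4, r5, r6, r7] ∈ candRanks false E := by
  obtain ⟨σ, hσ, e1, e2, e3, e6⟩ := hm
  rw [candRanks]
  simp only [hb, List.getD_cons_zero, List.getD_cons_succ, List.mem_flatMap, List.mem_cons,
    List.mem_filterMap, Bool.false_eq_true, ↓reduceIte, List.not_mem_nil, or_false]
  rcases ht with ht | ht
  · refine ⟨(r4, r5), Or.inl (by rw [ht]; rfl), σ, hσ, ?_⟩
    rw [e1, e2, e3, e6, hv]; rfl
  · refine ⟨(r4, r5), Or.inr (by rw [ht]; rfl), σ, hσ, ?_⟩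
    rw [e1, e2, e3, e6, hv]; rfl

/-- Membership in `validPats` from membership in a chunk. [cite: Rechnitzer2006Haruspicy2, Lemma 21] -/
theorem mem_validPats_of {P : LPat} {e : ℕ} (he1 : 1 ≤ e) (he7 : e ≤ 7) {E' : List ℕ} (hE : P.E = e :: E')
    (hchunk : e :: E' ∈ seqsChunk e) (hcand : P.r ∈ candRanks P.isA P.E)
    (hcons : pconsistent P.isA P.E P.r = true) : P ∈ validPats := by
  rw [validPats, List.mem_flatMap]
  refine ⟨e - 1, List.mem_range.mpr (by omega), ?_⟩
  rw [show e - 1 + 1 = e by omega, List.mem_append]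
  obtain ⟨isA, E, r⟩ := P
  simp only at hE hcand hcons
  subst hE
  cases isA
  · right
    rw [validPatsChunk, List.mem_flatMap]
    exact ⟨_, hchunk, List.mem_map.mpr ⟨r, List.mem_filter.mpr ⟨hcand, hcons⟩, rfl⟩⟩
  · left
    rw [validPatsChunk, List.mem_flatMap]
    exact ⟨_, hchunk, List.mem_map.mpr ⟨r, List.mem_filter.mpr ⟨hcand, hcons⟩, rfl⟩⟩

/-- **What membership in `validPats` gives**: the rank vector passed `pdisj` and `pconsistent`.
[cite: Rechnitzer2006Haruspicy2, Lemma 21] -/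
theorem of_mem_validPats {P : LPat} (h : P ∈ validPats) :
    pdisj P.isA P.r = true ∧ pconsistent P.isA P.E P.r = true := by
  rw [validPats, List.mem_flatMap] at h
  obtain ⟨i, -, h⟩ := h
  have key : ∀ (isA : Bool) (E : List ℕ) (r : List ℕ), r ∈ candRanks isA E → pdisj isA r = true := by
    intro isA E r hr
    rw [candRanks] at hr
    simp only [List.mem_flatMap, List.mem_filterMap] at hr
    obtain ⟨tt, -, σ, -, hσ⟩ := hr
    cases isA
    · simp only [Bool.false_eq_true, ↓reduceIte] at hσ
      split_ifs at hσ with hv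
      simp only [Option.some.injEq] at hσ
      rw [← hσ]; exact hv
    · simp only [↓reduceIte] at hσ
      split_ifs at hσ with hv
      simp only [Option.some.injEq] at hσ
      rw [← hσ]; exact hv
  rw [List.mem_append] at h
  rcases h with h | h <;>
  · rw [validPatsChunk, List.mem_flatMap] at h
    obtain ⟨E, -, h⟩ := h
    rw [List.mem_map] at h
    obtain ⟨r, hr, rfl⟩ := h
    rw [List.mem_filter] at hr
    exact ⟨key _ _ _ hr.1, hr.2⟩

end Membership

/-! ### The labelled pattern of building-block data -/

noncomputable section

section Pattern

open Finset

variable (isA : Bool) (ℓ : Fin 8 → ℤ)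

/-- The columns `c_j = X_{j+1}` of the eight vertical letters (`c_7 = X_8`, the closing column).
[cite: Rechnitzer2006Haruspicy2, Lemma 21] -/
def cols (j : Fin 8) : ℤ := mX (bbMoves isA ℓ) ((j : ℕ) + 1)

/-- The distinct columns, increasingly. [folklore] -/
def sortedCols : List ℤ := (univ.image (cols isA ℓ)).sort

/-- The number of distinct columns (the number of events). [folklore] -/
def numCols : ℕ := (sortedCols isA ℓ).length

/-- The rank of the column of the `j`-th vertical letter among the distinct columns. [folklore] -/
def rankOf (j : Fin 8) : ℕ := (sortedCols isA ℓ).idxOf (cols isA ℓ j)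

/-- The event at rank `i`: the code of the set of rows of the vertical letters in that column.
[cite: Rechnitzer2006Haruspicy2, Lemma 21] -/
def evAt (i : ℕ) : ℕ :=
  (if ∃ j : Fin 8, ptTag isA j = 0 ∧ rankOf isA ℓ j = i then 1 else 0) +
  (if ∃ j : Fin 8, ptTag isA j = 1 ∧ rankOf isA ℓ j = i then 2 else 0) +
  (if ∃ j : Fin 8, ptTag isA j = 2 ∧ rankOf isA ℓ j = i then 4 else 0)

/-- **The labelled pattern of building-block data.** [cite: Rechnitzer2006Haruspicy2, Lemma 21] -/
def patOf : LPat := ⟨isA, (List.range (numCols isA ℓ)).map (evAt isA ℓ), List.ofFn (rankOf isA ℓ)⟩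

/-- The gaps between consecutive distinct columns. [folklore] -/
def bbGap (i : ℕ) : ℕ := ((sortedCols isA ℓ).getD (i + 1) 0 - (sortedCols isA ℓ).getD i 0).toNat

variable {isA ℓ}

/-- Membership in the sorted columns. [folklore] -/
theorem mem_sortedCols_iff {a : ℤ} : a ∈ sortedCols isA ℓ ↔ ∃ j, cols isA ℓ j = a := by
  rw [sortedCols, Finset.mem_sort, Finset.mem_image]; simp

/-- Every column is among the sorted columns. [folklore] -/
theorem cols_mem_sortedCols (j : Fin 8) : cols isA ℓ j ∈ sortedCols isA ℓ :=
  mem_sortedCols_iff.mpr ⟨j, rfl⟩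

/-- The sorted columns have no duplicates. [folklore] -/
theorem nodup_sortedCols : (sortedCols isA ℓ).Nodup := Finset.sort_nodup _ _

/-- Equal indices give equal entries (with any bounds proofs). [folklore] -/
theorem getElem_congr_idx {l : List ℤ} {a b : ℕ} (ha : a < l.length) (hb : b < l.length) (h : a = b) :
    l[a] = l[b] := by subst h; rfl

/-- Ranks are below the number of columns. [folklore] -/
theorem rankOf_lt (j : Fin 8) : rankOf isA ℓ j < numCols isA ℓ :=
  List.idxOf_lt_length_of_mem (cols_mem_sortedCols j)

/-- The sorted columns are strictly increasing. [folklore] -/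
theorem sortedLT_sortedCols : (sortedCols isA ℓ).SortedLT := Finset.sortedLT_sort _

/-- The column of rank `rankOf j` is `cols j`. [folklore] -/
theorem getElem_rankOf (j : Fin 8) :
    (sortedCols isA ℓ)[rankOf isA ℓ j]'(rankOf_lt j) = cols isA ℓ j :=
  List.getElem_idxOf (rankOf_lt j)

/-- Ranks compare as columns do. [folklore] -/
theorem rankOf_lt_rankOf_iff (j k : Fin 8) : rankOf isA ℓ j < rankOf isA ℓ k ↔ cols isA ℓ j < cols isA ℓ k := by
  rw [← sortedLT_sortedCols.getElem_lt_getElem_iff (hi := rankOf_lt j) (hj := rankOf_lt k),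
    getElem_rankOf, getElem_rankOf]

/-- Ranks compare as columns do. [folklore] -/
theorem rankOf_le_rankOf_iff (j k : Fin 8) : rankOf isA ℓ j ≤ rankOf isA ℓ k ↔ cols isA ℓ j ≤ cols isA ℓ k := by
  rw [← not_lt, rankOf_lt_rankOf_iff, not_lt]

/-- Ranks coincide iff columns do. [folklore] -/
theorem rankOf_eq_rankOf_iff (j k : Fin 8) : rankOf isA ℓ j = rankOf isA ℓ k ↔ cols isA ℓ j = cols isA ℓ k := by
  constructor
  · intro h
    rw [← getElem_rankOf j, ← getElem_rankOf k]
    exact getElem_congr_idx _ _ h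
  · intro h
    show (sortedCols isA ℓ).idxOf (cols isA ℓ j) = (sortedCols isA ℓ).idxOf (cols isA ℓ k)
    rw [h]

/-- Every index below the number of columns is a rank. [folklore] -/
theorem exists_rankOf_eq {i : ℕ} (hi : i < numCols isA ℓ) : ∃ j, rankOf isA ℓ j = i := by
  obtain ⟨j, hj⟩ := mem_sortedCols_iff.mp (List.getElem_mem hi)
  refine ⟨j, ?_⟩
  show (sortedCols isA ℓ).idxOf (cols isA ℓ j) = i
  rw [hj]
  exact nodup_sortedCols.idxOf_getElem i hi

/-- At most eight columns … [folklore] -/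
theorem numCols_le : numCols isA ℓ ≤ 8 := by
  rw [numCols, sortedCols, Finset.length_sort]
  exact (Finset.card_image_le).trans (by simp)

/-- … and at least one. [folklore] -/
theorem numCols_pos : 0 < numCols isA ℓ := (Nat.zero_le _).trans_lt (rankOf_lt 0)

/-- Row tags are `0, 1, 2`. [folklore] -/
theorem ptTag_lt (isA : Bool) (j : ℕ) : ptTag isA j < 3 := by
  unfold ptTag
  rcases Nat.lt_or_ge j 8 with h | h
  · interval_cases j <;> cases isA <;> decide
  · have e1 : ([0, 1, 2, 2, 1, 1, 1, 0] : List ℕ).getD j 0 = 0 := by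
      rw [List.getD_eq_getElem?_getD, List.getElem?_eq_none_iff.mpr (by simpa using h)]; rfl
    have e2 : ([0, 1, 1, 1, 2, 2, 1, 0] : List ℕ).getD j 0 = 0 := by
      rw [List.getD_eq_getElem?_getD, List.getElem?_eq_none_iff.mpr (by simpa using h)]; rfl
    cases isA <;> simp only [Bool.false_eq_true, if_true, if_false, e1, e2] <;> norm_num

/-- The bits of a code assembled from bits. [folklore] -/
theorem hasTag_bits (a b c : Prop) [Decidable a] [Decidable b] [Decidable c] :
    (hasTag 0 ((if a then 1 else 0) + (if b then 2 else 0) + (if c then 4 else 0)) = true ↔ a) ∧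
    (hasTag 1 ((if a then 1 else 0) + (if b then 2 else 0) + (if c then 4 else 0)) = true ↔ b) ∧
    (hasTag 2 ((if a then 1 else 0) + (if b then 2 else 0) + (if c then 4 else 0)) = true ↔ c) := by
  by_cases ha : a <;> by_cases hb : b <;> by_cases hc : c <;> simp [ha, hb, hc, hasTag]

/-- The rows present in the event at rank `i`. [folklore] -/
theorem hasTag_evAt_iff {tag : ℕ} (htag : tag < 3) (i : ℕ) :
    hasTag tag (evAt isA ℓ i) = true ↔ ∃ j : Fin 8, ptTag isA j = tag ∧ rankOf isA ℓ j = i := by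
  obtain ⟨h0, h1, h2⟩ := hasTag_bits (∃ j : Fin 8, ptTag isA j = 0 ∧ rankOf isA ℓ j = i)
    (∃ j : Fin 8, ptTag isA j = 1 ∧ rankOf isA ℓ j = i) (∃ j : Fin 8, ptTag isA j = 2 ∧ rankOf isA ℓ j = i)
  interval_cases tag
  · exact h0
  · exact h1
  · exact h2

/-- A code assembled from bits is below `8` … [folklore] -/
theorem evAt_lt (i : ℕ) : evAt isA ℓ i < 8 := by
  unfold evAt; split_ifs <;> norm_num

/-- … and positive at every rank. [folklore] -/
theorem evAt_pos {i : ℕ} (hi : i < numCols isA ℓ) : 1 ≤ evAt isA ℓ i := by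
  obtain ⟨j, hj⟩ := exists_rankOf_eq hi
  have ht := ptTag_lt isA j
  unfold evAt
  interval_cases h : ptTag isA j
  · rw [if_pos ⟨j, h, hj⟩]; omega
  · rw [if_pos (c := ∃ j : Fin 8, ptTag isA j = 1 ∧ rankOf isA ℓ j = i) ⟨j, h, hj⟩]; omega
  · rw [if_pos (c := ∃ j : Fin 8, ptTag isA j = 2 ∧ rankOf isA ℓ j = i) ⟨j, h, hj⟩]; omega

/-- A code below `8` is assembled from its bits. [folklore] -/
theorem eq_bits {e : ℕ} (he : e < 8) :
    e = (if hasTag 0 e = true then 1 else 0) + (if hasTag 1 e = true then 2 else 0) + (if hasTag 2 e = true then 4 else 0) := by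
  interval_cases e <;> decide

end Pattern

/-! ### Data from a labelled pattern and gaps -/

section EllOf

open Finset

/-- Partial sums of the gaps: the position of the column of rank `i` relative to the leftmost.
[folklore] -/
def posOf (n : ℕ → ℕ) (i : ℕ) : ℤ := ∑ i' ∈ range i, (n i' : ℤ)

/-- The column of the start of move `k` for the pattern `P` and gaps `n`, normalised so that the
closing column `X_8 = X_0` is `0`. [folklore] -/
def colOf (P : LPat) (n : ℕ → ℕ) (k : ℕ) : ℤ := posOf n (rk P.r k) - posOf n (P.r.getD 7 0)

/-- **The building-block data of a labelled pattern and gaps**: `ℓ_k = X_{k+1} - X_k`.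
[cite: Rechnitzer2006Haruspicy2, Lemma 21] -/
def ellOf (P : LPat) (n : ℕ → ℕ) : Fin 8 → ℤ := fun k => colOf P n ((k : ℕ) + 1) - colOf P n k

/-- `posOf` one step on. [folklore] -/
theorem posOf_succ (n : ℕ → ℕ) (i : ℕ) : posOf n (i + 1) = posOf n i + n i := by
  rw [posOf, posOf, Finset.sum_range_succ]

/-- `posOf` is monotone. [folklore] -/
theorem posOf_mono (n : ℕ → ℕ) {a b : ℕ} (hab : a ≤ b) : posOf n a ≤ posOf n b := by
  induction b, hab using Nat.le_induction with
  | base => exact le_rfl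
  | succ b _ ih => rw [posOf_succ]; have := Int.natCast_nonneg (n b); omega

/-- `posOf` is strictly monotone below `N` when the gaps below `N` are positive. [folklore] -/
theorem posOf_lt_posOf (n : ℕ → ℕ) {N : ℕ} (hn : ∀ i < N, 1 ≤ n i) {a b : ℕ} (hab : a < b) (hb : b ≤ N) :
    posOf n a < posOf n b := by
  have h1 : posOf n a < posOf n (a + 1) := by rw [posOf_succ]; have := hn a (by omega); omega
  exact h1.trans_le (posOf_mono n hab)

/-- Differences of `posOf` are interval sums of gaps. [folklore] -/
theorem posOf_sub_posOf (n : ℕ → ℕ) {a b : ℕ} (hab : a ≤ b) {N : ℕ} (hbN : b ≤ N) :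
    posOf n b - posOf n a = ∑ i ∈ range N, if a ≤ i ∧ i < b then (n i : ℤ) else 0 := by
  rw [posOf, posOf, ← Finset.sum_Ico_eq_sub _ hab, ← Finset.sum_filter]
  congr 1
  ext i
  simp only [Finset.mem_Ico, Finset.mem_filter, Finset.mem_range]
  omega

/-- The absolute difference of `posOf` at two ranks is the sum of the gaps covered by the run.
[folklore] -/
theorem natAbs_posOf_sub (n : ℕ → ℕ) {a b N : ℕ} (ha : a ≤ N) (hb : b ≤ N) :
    (posOf n b - posOf n a).natAbs = ∑ i ∈ range N, if min a b ≤ i ∧ i < max a b then n i else 0 := by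
  have cast : ∀ a b, a ≤ b → b ≤ N → (posOf n b - posOf n a).natAbs =
      ∑ i ∈ range N, if a ≤ i ∧ i < b then n i else 0 := by
    intro a b hab hbN
    have h := posOf_sub_posOf n hab hbN
    have hnn : 0 ≤ posOf n b - posOf n a := by have := posOf_mono n hab; omega
    have key : ((posOf n b - posOf n a).natAbs : ℤ) = ((∑ i ∈ range N, if a ≤ i ∧ i < b then n i else 0 : ℕ) : ℤ) := by
      rw [Int.natAbs_of_nonneg hnn, h]
      push_cast
      exact Finset.sum_congr rfl fun i _ => by split_ifs <;> simp
    exact_mod_cast key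
  rcases le_total a b with hab | hab
  · rw [min_eq_left hab, max_eq_right hab]; exact cast a b hab hb
  · rw [min_eq_right hab, max_eq_left hab, ← cast b a hab ha, ← Int.natAbs_neg, neg_sub]

variable (P : LPat) (n : ℕ → ℕ)

/-- `rk` at `0` and `8` is the rank of the closing column. [folklore] -/
theorem rk_zero : rk P.r 0 = P.r.getD 7 0 := by simp [rk]

/-- `rk` in the middle. [folklore] -/
theorem rk_of_pos {k : ℕ} (h1 : 1 ≤ k) (h7 : k ≤ 7) : rk P.r k = P.r.getD (k - 1) 0 := by
  unfold rk; rw [if_neg (by omega)]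

/-- `rk` at `8`. [folklore] -/
theorem rk_eight : rk P.r 8 = P.r.getD 7 0 := by simp [rk]

/-- The closing column is `0` … [folklore] -/
theorem colOf_zero : colOf P n 0 = 0 := by rw [colOf, rk_zero, sub_self]

/-- … at both ends. [folklore] -/
theorem colOf_eight : colOf P n 8 = 0 := by rw [colOf, rk_eight, sub_self]

/-- **The columns of the data of a pattern**: `X_k = colOf P n k`. [folklore] -/
theorem mX_bbMoves_ellOf {k : ℕ} (hk : k ≤ 8) : mX (bbMoves P.isA (ellOf P n)) k = colOf P n k := by
  induction k with
  | zero => rw [mX_zero, colOf_zero]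
  | succ k ih =>
    rw [mX_succ _ (by simp; omega), ih (by omega),
      show mL (bbMoves P.isA (ellOf P n)) k = ellOf P n ⟨k, by omega⟩ from mL_bbMoves P.isA (ellOf P n) ⟨k, by omega⟩,
      ellOf]
    simp

/-- The runs of the data of a pattern sum to zero. [folklore] -/
theorem sum_ellOf : ∑ i : Fin 8, ellOf P n i = 0 := by
  have h := mX_bbMoves_ellOf P n (k := 8) le_rfl
  rw [mX_bbMoves _ _ le_rfl, colOf_eight] at h
  simpa using h

end EllOf

/-! ### Soundness: valid patterns and positive gaps give valid data -/

section Soundness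

open Finset

/-- The properties of a valid labelled pattern, unpacked from the Boolean filters. [folklore] -/
structure PProps (P : LPat) : Prop where
  /-- eight ranks -/
  len : P.r.length = 8
  /-- ranks are event indices -/
  rlt : ∀ j < 8, P.r.getD j 0 < P.E.length
  /-- the event of a letter carries its row -/
  tag_of : ∀ j < 8, hasTag (ptTag P.isA j) (P.E.getD (P.r.getD j 0) 0) = true
  /-- events are codes `1…7` -/
  ev_pos : ∀ i < P.E.length, 1 ≤ P.E.getD i 0
  /-- events are codes `1…7` -/
  ev_lt : ∀ i < P.E.length, P.E.getD i 0 < 8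
  /-- every row of an event is attained -/
  of_tag : ∀ i < P.E.length, ∀ tag < 3, hasTag tag (P.E.getD i 0) = true →
    ∃ j < 8, ptTag P.isA j = tag ∧ P.r.getD j 0 = i
  /-- the bottom row is read eastwards -/
  r7_lt : P.r.getD 7 0 < P.r.getD 0 0
  /-- same-height runs are disjoint, on ranks -/
  disj : ∀ k k', k < k' → k' < 8 → bbHtN P.isA k = bbHtN P.isA k' →
    dj (rk P.r k) (rk P.r (k + 1)) (rk P.r k') (rk P.r (k' + 1)) = true

/-- `pdisj` holds only on eight ranks passing `valid8`. [folklore] -/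
theorem pdisj_iff (isA : Bool) (r : List ℕ) : pdisj isA r = true ↔
    ∃ r0 r1 r2 r3 r4 r5 r6 r7, r = [r0, r1, r2, r3, r4, r5, r6, r7] ∧ valid8 isA r0 r1 r2 r3 r4 r5 r6 r7 = true := by
  constructor
  · intro h
    unfold pdisj at h
    split at h
    · exact ⟨_, _, _, _, _, _, _, _, rfl, h⟩
    · exact absurd h (by decide)
  · rintro ⟨r0, r1, r2, r3, r4, r5, r6, r7, rfl, hv⟩
    exact hv

/-- **Unpacking membership in `validPats`.** [cite: Rechnitzer2006Haruspicy2, Lemma 21] -/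
theorem PProps.of_mem {P : LPat} (h : P ∈ validPats) : PProps P := by
  obtain ⟨hpd, hpc⟩ := of_mem_validPats h
  have hall := pdisjAll_of_mem h
  obtain ⟨r0, r1, r2, r3, r4, r5, r6, r7, hr, hv⟩ := (pdisj_iff _ _).mp hpd
  simp only [pconsistent, Bool.and_eq_true, beq_iff_eq, List.all_eq_true, List.mem_range, Nat.blt_eq,
    Bool.or_eq_true, Bool.not_eq_true', List.any_eq_true] at hpc
  obtain ⟨⟨hlen, h2⟩, h3⟩ := hpc
  refine ⟨hlen, fun j hj => (h2 j hj).1, fun j hj => (h2 j hj).2, fun i hi => (h3 i hi).1.1, fun i hi => (h3 i hi).1.2,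
    fun i hi tag htag hh => ?_, ?_, fun k k' hkk' hk' hy => ?_⟩
  · rcases (h3 i hi).2 tag htag with h' | ⟨j, hj, hj'⟩
    · rw [hh] at h'; exact absurd h' (by decide)
    · exact ⟨j, hj, hj'⟩
  · rw [hr]
    have := hv
    unfold valid8 at this
    rw [Bool.and_eq_true, Nat.blt_eq] at this
    simpa using this.1
  · simp only [pdisjAll, List.all_eq_true, List.mem_range] at hall
    have h1 := hall k (by omega) k' hk'
    have hkk : Nat.blt k k' = true := by simpa using hkk'
    have hyy : (bbHtN P.isA k == bbHtN P.isA k') = true := beq_iff_eq.mpr hy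
    rw [hkk, hyy] at h1
    simpa using h1

variable {P : LPat} (hP : PProps P) {n : ℕ → ℕ} (hn : ∀ i < P.E.length - 1, 1 ≤ n i)
include hP hn

omit hn in
/-- Ranks of run ends are event indices. [folklore] -/
theorem PProps.rk_lt (k : ℕ) : rk P.r k < P.E.length := by
  unfold rk; split_ifs with h
  · exact hP.rlt 7 (by norm_num)
  · rcases Nat.lt_or_ge (k - 1) 8 with h8 | h8
    · exact hP.rlt _ h8
    · rw [List.getD_eq_getElem?_getD, List.getElem?_eq_none_iff.mpr (by rw [hP.len]; omega)]
      exact (Nat.zero_le _).trans_lt (hP.rlt 7 (by norm_num))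

/-- Disjoint runs on ranks give disjoint runs on columns. [folklore] -/
theorem PProps.runsDisjoint_colOf {k k' : ℕ} (hd : dj (rk P.r k) (rk P.r (k + 1)) (rk P.r k') (rk P.r (k' + 1)) = true) :
    RunsDisjoint (colOf P n k) (colOf P n (k + 1) - colOf P n k) (colOf P n k') (colOf P n (k' + 1) - colOf P n k') := by
  have hmono : ∀ a b : ℕ, a < b → b < P.E.length → posOf n a < posOf n b := fun a b hab hb =>
    posOf_lt_posOf n (N := P.E.length - 1) hn hab (by omega)
  have l1 := hP.rk_lt k; have l2 := hP.rk_lt (k + 1); have l3 := hP.rk_lt k'; have l4 := hP.rk_lt (k' + 1)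
  unfold RunsDisjoint colOf
  simp only [add_sub_cancel]
  unfold dj at hd
  rw [Bool.or_eq_true, Nat.blt_eq, Nat.blt_eq, max_lt_iff, max_lt_iff, lt_min_iff, lt_min_iff, lt_min_iff,
    lt_min_iff] at hd
  rcases hd with ⟨⟨a1, a2⟩, ⟨a3, a4⟩⟩ | ⟨⟨a1, a2⟩, ⟨a3, a4⟩⟩
  · left
    have b1 := hmono _ _ a1 l3; have b2 := hmono _ _ a2 l4; have b3 := hmono _ _ a3 l3; have b4 := hmono _ _ a4 l4
    simp only [max_lt_iff, lt_min_iff]; omega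
  · right
    have b1 := hmono _ _ a1 l1; have b2 := hmono _ _ a2 l2; have b3 := hmono _ _ a3 l1; have b4 := hmono _ _ a4 l2
    simp only [max_lt_iff, lt_min_iff]; omega

omit hP hn in
/-- The heights of the runs, integer and natural versions. [folklore] -/
theorem mY_bbMoves_eq_bbHtN (isA : Bool) (ℓ : Fin 8 → ℤ) {k : ℕ} (hk : k < 8) :
    mY (bbMoves isA ℓ) k = (bbHtN isA k : ℤ) := by
  rw [mY_bbMoves _ _ hk.le]
  interval_cases k <;> cases isA <;> rfl

omit hP hn in
/-- **Soundness**: a valid labelled pattern with positive gaps gives valid building-block data.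
[cite: Rechnitzer2006Haruspicy2, Lemma 21] -/
theorem bbValid_ellOf (hmem : P ∈ validPats) (hn : ∀ i < P.E.length - 1, 1 ≤ n i) : BBValid P.isA (ellOf P n) := by
  have hP := PProps.of_mem hmem
  refine ⟨sum_ellOf P n, ?_, fun k k' hkk' hk' hy => ?_⟩
  · -- the bottom row `ℓ₀ = pos r₀ - pos r₇ ≥ 1`
    show 1 ≤ colOf P n 1 - colOf P n 0
    rw [colOf_zero, sub_zero, colOf, rk_of_pos P (le_refl 1) (by norm_num), Nat.sub_self]
    have := posOf_lt_posOf n (N := P.E.length - 1) hn hP.r7_lt (by have := hP.rlt 0 (by norm_num); omega)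
    omega
  · rw [mX_bbMoves_ellOf P n (by omega), mX_bbMoves_ellOf P n (by omega),
      show mL (bbMoves P.isA (ellOf P n)) k = ellOf P n ⟨k, by omega⟩ from mL_bbMoves _ _ ⟨k, by omega⟩,
      show mL (bbMoves P.isA (ellOf P n)) k' = ellOf P n ⟨k', by omega⟩ from mL_bbMoves _ _ ⟨k', by omega⟩]
    refine hP.runsDisjoint_colOf hn (hP.disj k k' hkk' hk' ?_)
    rw [mY_bbMoves_eq_bbHtN _ _ (by omega), mY_bbMoves_eq_bbHtN _ _ hk'] at hy
    exact_mod_cast hy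

end Soundness

/-! ### The pattern of the data of a pattern is the pattern (round trip on patterns) -/

section RoundTrip

open Finset

variable {P : LPat} (hP : PProps P) {n : ℕ → ℕ} (hn : ∀ i < P.E.length - 1, 1 ≤ n i)
include hP hn

omit hn in
/-- Every event index is the rank of some letter. [folklore] -/
theorem PProps.exists_r_eq {i : ℕ} (hi : i < P.E.length) : ∃ j < 8, P.r.getD j 0 = i := by
  have hpos := hP.ev_pos i hi
  have hlt := hP.ev_lt i hi
  have : ∃ tag < 3, hasTag tag (P.E.getD i 0) = true := by
    generalize P.E.getD i 0 = e at hpos hlt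
    interval_cases e <;> decide
  obtain ⟨tag, htag, hh⟩ := this
  obtain ⟨j, hj, -, hji⟩ := hP.of_tag i hi tag htag hh
  exact ⟨j, hj, hji⟩

omit hP hn in
/-- The columns of the data of a pattern: `c_j = pos r_j - pos r_7`. [folklore] -/
theorem cols_ellOf (P : LPat) (n : ℕ → ℕ) (j : Fin 8) :
    cols P.isA (ellOf P n) j = posOf n (P.r.getD j 0) - posOf n (P.r.getD 7 0) := by
  rw [cols, mX_bbMoves_ellOf P n (by omega), colOf]
  rcases Nat.lt_or_ge (j : ℕ) 7 with h | h
  · rw [rk_of_pos P (by omega) (by omega)]; simp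
  · have : (j : ℕ) = 7 := by omega
    rw [this, rk_eight]

/-- The sorted columns of the data of a pattern: `pos i - pos r_7`, `i < |E|`. [folklore] -/
theorem PProps.sortedCols_ellOf :
    sortedCols P.isA (ellOf P n) = (List.range P.E.length).map fun i => posOf n i - posOf n (P.r.getD 7 0) := by
  have hmono : ∀ a b : ℕ, a < b → b < P.E.length →
      posOf n a - posOf n (P.r.getD 7 0) < posOf n b - posOf n (P.r.getD 7 0) := fun a b hab hb => by
    have := posOf_lt_posOf n (N := P.E.length - 1) hn hab (by omega); omega
  apply sortedLT_sortedCols.eq_of_mem_iff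
  · rw [List.sortedLT_iff_pairwise, List.pairwise_map]
    exact List.Pairwise.imp_of_mem (fun {a b} ha hb hab => hmono a b hab (List.mem_range.mp hb))
      List.pairwise_lt_range
  · intro a
    rw [mem_sortedCols_iff, List.mem_map]
    constructor
    · rintro ⟨j, rfl⟩
      exact ⟨P.r.getD j 0, List.mem_range.mpr (hP.rlt j j.isLt), (cols_ellOf P n j).symm⟩
    · rintro ⟨i, hi, rfl⟩
      obtain ⟨j, hj, hji⟩ := hP.exists_r_eq (List.mem_range.mp hi)
      exact ⟨⟨j, hj⟩, by rw [cols_ellOf P n, hji]⟩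

/-- Hence the number of columns of the data of a pattern is the number of events … [folklore] -/
theorem PProps.numCols_ellOf : numCols P.isA (ellOf P n) = P.E.length := by
  rw [numCols, hP.sortedCols_ellOf hn, List.length_map, List.length_range]

/-- … the ranks are the ranks … [folklore] -/
theorem PProps.rankOf_ellOf (j : Fin 8) : rankOf P.isA (ellOf P n) j = P.r.getD j 0 := by
  have hnd : ((List.range P.E.length).map fun i => posOf n i - posOf n (P.r.getD 7 0)).Nodup := by
    rw [← hP.sortedCols_ellOf hn]; exact nodup_sortedCols
  have hlt : P.r.getD j 0 < ((List.range P.E.length).map fun i => posOf n i - posOf n (P.r.getD 7 0)).length := by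
    rw [List.length_map, List.length_range]; exact hP.rlt j j.isLt
  have key := hnd.idxOf_getElem _ hlt
  rw [List.getElem_map, List.getElem_range] at key
  rw [rankOf, hP.sortedCols_ellOf hn, cols_ellOf P n]
  exact key

/-- … the events are the events … [folklore] -/
theorem PProps.evAt_ellOf {i : ℕ} (hi : i < P.E.length) : evAt P.isA (ellOf P n) i = P.E.getD i 0 := by
  have hbit : ∀ tag < 3, (∃ j : Fin 8, ptTag P.isA j = tag ∧ rankOf P.isA (ellOf P n) j = i) ↔
      hasTag tag (P.E.getD i 0) = true := by
    intro tag htag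
    constructor
    · rintro ⟨j, hjt, hji⟩
      rw [hP.rankOf_ellOf hn] at hji
      have := hP.tag_of j j.isLt
      rwa [hji, hjt] at this
    · intro hh
      obtain ⟨j, hj, hjt, hji⟩ := hP.of_tag i hi tag htag hh
      exact ⟨⟨j, hj⟩, hjt, by rw [hP.rankOf_ellOf hn]; exact hji⟩
  rw [eq_bits (hP.ev_lt i hi), evAt]
  have e0 := hbit 0 (by norm_num); have e1 := hbit 1 (by norm_num); have e2 := hbit 2 (by norm_num)
  simp only [e0, e1, e2]

/-- … and the gaps are the gaps: **the pattern of the data of a valid pattern is the pattern.**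
[cite: Rechnitzer2006Haruspicy2, Lemma 21] -/
theorem PProps.patOf_ellOf : patOf P.isA (ellOf P n) = P := by
  obtain ⟨isA, E, r⟩ := P
  simp only [patOf, LPat.mk.injEq, true_and]
  constructor
  · apply List.ext_getElem
    · rw [List.length_map, List.length_range, hP.numCols_ellOf hn]
    · intro i h1 h2
      rw [List.getElem_map, List.getElem_range, hP.evAt_ellOf hn h2]
      exact (List.getD_eq_getElem _ _ h2)
  · apply List.ext_getElem
    · rw [List.length_ofFn, hP.len]
    · intro i h1 h2
      rw [List.getElem_ofFn, hP.rankOf_ellOf hn]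
      exact (List.getD_eq_getElem _ _ h2)

/-- The gaps of the data of a valid pattern are the gaps. [folklore] -/
theorem PProps.bbGap_ellOf {i : ℕ} (hi : i + 1 < P.E.length) : bbGap P.isA (ellOf P n) i = n i := by
  rw [bbGap, hP.sortedCols_ellOf hn]
  simp only [List.getD_eq_getElem?_getD, List.getElem?_map, List.getElem?_range hi,
    List.getElem?_range (show i < P.E.length by omega), Option.map_some, Option.getD_some, posOf_succ]
  omega

end RoundTrip

/-! ### Completeness: the pattern of valid data is in the enumeration -/

section Completeness

open Finset

variable {isA : Bool} {ℓ : Fin 8 → ℤ} (h : BBValid isA ℓ)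
include h

/-- Disjointness of same-height runs, on the columns `X_k`. [folklore] -/
theorem BBValid.disjX {k k' : ℕ} (hkk' : k < k') (hk' : k' < 8) (hy : bbHtN isA k = bbHtN isA k') :
    max (mX (bbMoves isA ℓ) k) (mX (bbMoves isA ℓ) (k + 1)) < min (mX (bbMoves isA ℓ) k') (mX (bbMoves isA ℓ) (k' + 1)) ∨
    max (mX (bbMoves isA ℓ) k') (mX (bbMoves isA ℓ) (k' + 1)) < min (mX (bbMoves isA ℓ) k) (mX (bbMoves isA ℓ) (k + 1)) := by
  have hd := h.disj k k' hkk' hk' (by rw [mY_bbMoves_eq_bbHtN _ _ (by omega), mY_bbMoves_eq_bbHtN _ _ hk', hy])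
  unfold RunsDisjoint at hd
  rwa [← mX_succ _ (by simp; omega), ← mX_succ _ (by simp; omega)] at hd

/-- `X_0 = 0`, `X_1 = ℓ₀ ≥ 1`, `X_8 = 0`. [folklore] -/
theorem BBValid.mX_ends : mX (bbMoves isA ℓ) 0 = 0 ∧ 1 ≤ mX (bbMoves isA ℓ) 1 ∧ mX (bbMoves isA ℓ) 8 = 0 := by
  refine ⟨mX_zero _, ?_, ?_⟩
  · rw [mX_succ _ (by simp), mX_zero, zero_add, show mL (bbMoves isA ℓ) 0 = ℓ 0 from mL_bbMoves isA ℓ 0]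
    exact h.pos
  · rw [mX_bbMoves _ _ le_rfl]; simpa using h.sum

/-- **Letters in the same row sit in distinct columns** (else two same-height runs would meet):
`cols` is injective on each row class. [folklore] -/
theorem BBValid.cols_injOn {j k : Fin 8} (ht : ptTag isA j = ptTag isA k) (hc : cols isA ℓ j = cols isA ℓ k) : j = k := by
  obtain ⟨e0, e1, e8⟩ := h.mX_ends
  simp only [cols] at hc
  cases isA
  · -- shape B: T-letters end the moves 4, 5; M-letters the moves 1, 2, 3, 6; B-letters 0, 7
    have d13 := h.disjX (k := 1) (k' := 3) (by norm_num) (by norm_num) rfl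
    have d17 := h.disjX (k := 1) (k' := 7) (by norm_num) (by norm_num) rfl
    have d37 := h.disjX (k := 3) (k' := 7) (by norm_num) (by norm_num) rfl
    have d24 := h.disjX (k := 2) (k' := 4) (by norm_num) (by norm_num) rfl
    have d26 := h.disjX (k := 2) (k' := 6) (by norm_num) (by norm_num) rfl
    have d46 := h.disjX (k := 4) (k' := 6) (by norm_num) (by norm_num) rfl
    simp only [max_lt_iff, lt_min_iff, Nat.reduceAdd] at d13 d17 d37 d24 d26 d46
    fin_cases j <;> fin_cases k <;> simp [ptTag] at ht ⊢ <;> norm_num at hc <;> omega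
  · have d15 := h.disjX (k := 1) (k' := 5) (by norm_num) (by norm_num) rfl
    have d17 := h.disjX (k := 1) (k' := 7) (by norm_num) (by norm_num) rfl
    have d57 := h.disjX (k := 5) (k' := 7) (by norm_num) (by norm_num) rfl
    have d24 := h.disjX (k := 2) (k' := 4) (by norm_num) (by norm_num) rfl
    have d26 := h.disjX (k := 2) (k' := 6) (by norm_num) (by norm_num) rfl
    have d46 := h.disjX (k := 4) (k' := 6) (by norm_num) (by norm_num) rfl
    simp only [max_lt_iff, lt_min_iff, Nat.reduceAdd] at d15 d17 d57 d24 d26 d46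
    fin_cases j <;> fin_cases k <;> simp [ptTag] at ht ⊢ <;> norm_num at hc <;> omega

/-- Hence `rankOf` is injective on each row class. [folklore] -/
theorem BBValid.rankOf_injOn {j k : Fin 8} (ht : ptTag isA j = ptTag isA k)
    (hr : rankOf isA ℓ j = rankOf isA ℓ k) : j = k :=
  h.cols_injOn ht ((rankOf_eq_rankOf_iff j k).mp hr)

omit h in
/-- The row classes have `2`, `4`, `2` letters. [cite: Rechnitzer2006Haruspicy2, Lemma 21] -/
theorem card_filter_ptTag (isA : Bool) :
    (univ.filter fun j : Fin 8 => ptTag isA j = 0).card = 2 ∧ (univ.filter fun j : Fin 8 => ptTag isA j = 1).card = 4 ∧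
      (univ.filter fun j : Fin 8 => ptTag isA j = 2).card = 2 := by
  cases isA <;> decide

/-- **The row counts of the events of valid data are `2, 4, 2`.** [cite: Rechnitzer2006Haruspicy2, Lemma 21] -/
theorem BBValid.tagCount_evAt {tag : ℕ} (htag : tag < 3) :
    tagCount tag ((List.range (numCols isA ℓ)).map (evAt isA ℓ)) = (univ.filter fun j : Fin 8 => ptTag isA j = tag).card := by
  classical
  rw [tagCount, List.filter_map, List.length_map]
  rw [← List.toFinset_card_of_nodup (List.nodup_range.filter _)]
  rw [← Finset.card_image_of_injOn (f := rankOf isA ℓ) (s := univ.filter fun j : Fin 8 => ptTag isA j = tag)]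
  · congr 1
    ext i
    simp only [List.mem_toFinset, List.mem_filter, List.mem_range, Function.comp_apply, Finset.mem_image,
      Finset.mem_filter, Finset.mem_univ, true_and, hasTag_evAt_iff htag]
    constructor
    · rintro ⟨-, j, hjt, hji⟩; exact ⟨j, hjt, hji⟩
    · rintro ⟨j, hjt, hji⟩; exact ⟨hji ▸ rankOf_lt j, j, hjt, hji⟩
  · intro j hj k hk hjk
    simp only [Finset.coe_filter, Finset.mem_univ, true_and, Set.mem_setOf_eq] at hj hk
    exact h.rankOf_injOn (hj.trans hk.symm) hjk

omit h in
/-- `dj` on ranks from disjointness on columns. [folklore] -/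
theorem dj_rankOf_of_cols {isA : Bool} {ℓ : Fin 8 → ℤ} {a b c d : Fin 8}
    (hx : max (cols isA ℓ a) (cols isA ℓ b) < min (cols isA ℓ c) (cols isA ℓ d) ∨
      max (cols isA ℓ c) (cols isA ℓ d) < min (cols isA ℓ a) (cols isA ℓ b)) :
    dj (rankOf isA ℓ a) (rankOf isA ℓ b) (rankOf isA ℓ c) (rankOf isA ℓ d) = true := by
  unfold dj
  rw [Bool.or_eq_true, Nat.blt_eq, Nat.blt_eq]
  simp only [max_lt_iff, lt_min_iff, rankOf_lt_rankOf_iff] at hx ⊢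
  exact hx

/-- The rank vector of valid data passes `valid8`. [cite: Rechnitzer2006Haruspicy2, Lemma 21] -/
theorem BBValid.valid8_rankOf :
    valid8 isA (rankOf isA ℓ 0) (rankOf isA ℓ 1) (rankOf isA ℓ 2) (rankOf isA ℓ 3) (rankOf isA ℓ 4)
      (rankOf isA ℓ 5) (rankOf isA ℓ 6) (rankOf isA ℓ 7) = true := by
  obtain ⟨e0, e1, e8⟩ := h.mX_ends
  have h70 : rankOf isA ℓ 7 < rankOf isA ℓ 0 := by
    rw [rankOf_lt_rankOf_iff]; simp only [cols]; norm_num; omega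
  have hX : ∀ j : Fin 8, cols isA ℓ j = mX (bbMoves isA ℓ) ((j : ℕ) + 1) := fun j => rfl
  unfold valid8
  rw [Bool.and_eq_true]
  refine ⟨by simpa using h70, ?_⟩
  cases isA
  · simp only [Bool.false_eq_true, ↓reduceIte, Bool.and_eq_true]
    refine ⟨⟨⟨⟨⟨dj_rankOf_of_cols ?_, dj_rankOf_of_cols ?_⟩, dj_rankOf_of_cols ?_⟩, dj_rankOf_of_cols ?_⟩, dj_rankOf_of_cols ?_⟩, dj_rankOf_of_cols ?_⟩
    · have := h.disjX (k := 1) (k' := 3) (by norm_num) (by norm_num) rfl; simpa [hX] using this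
    · have := h.disjX (k := 1) (k' := 7) (by norm_num) (by norm_num) rfl; simpa [hX, e8] using this
    · have := h.disjX (k := 3) (k' := 7) (by norm_num) (by norm_num) rfl; simpa [hX, e8] using this
    · have := h.disjX (k := 2) (k' := 4) (by norm_num) (by norm_num) rfl; simpa [hX] using this
    · have := h.disjX (k := 2) (k' := 6) (by norm_num) (by norm_num) rfl; simpa [hX] using this
    · have := h.disjX (k := 4) (k' := 6) (by norm_num) (by norm_num) rfl; simpa [hX] using this
  · simp only [↓reduceIte, Bool.and_eq_true]
    refine ⟨⟨⟨⟨⟨dj_rankOf_of_cols ?_, dj_rankOf_of_cols ?_⟩, dj_rankOf_of_cols ?_⟩, dj_rankOf_of_cols ?_⟩, dj_rankOf_of_cols ?_⟩, dj_rankOf_of_cols ?_⟩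
    · have := h.disjX (k := 1) (k' := 5) (by norm_num) (by norm_num) rfl; simpa [hX] using this
    · have := h.disjX (k := 1) (k' := 7) (by norm_num) (by norm_num) rfl; simpa [hX, e8] using this
    · have := h.disjX (k := 5) (k' := 7) (by norm_num) (by norm_num) rfl; simpa [hX, e8] using this
    · have := h.disjX (k := 2) (k' := 4) (by norm_num) (by norm_num) rfl; simpa [hX] using this
    · have := h.disjX (k := 2) (k' := 6) (by norm_num) (by norm_num) rfl; simpa [hX] using this
    · have := h.disjX (k := 4) (k' := 6) (by norm_num) (by norm_num) rfl; simpa [hX] using this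

omit h in
/-- The fields of `patOf`. [folklore] -/
theorem patOf_E (isA : Bool) (ℓ : Fin 8 → ℤ) : (patOf isA ℓ).E = (List.range (numCols isA ℓ)).map (evAt isA ℓ) := rfl

omit h in
/-- The fields of `patOf`. [folklore] -/
theorem patOf_r (isA : Bool) (ℓ : Fin 8 → ℤ) : (patOf isA ℓ).r =
    [rankOf isA ℓ 0, rankOf isA ℓ 1, rankOf isA ℓ 2, rankOf isA ℓ 3, rankOf isA ℓ 4, rankOf isA ℓ 5, rankOf isA ℓ 6,
      rankOf isA ℓ 7] := by
  simp [patOf, List.ofFn_succ]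

omit h in
/-- The fields of `patOf`. [folklore] -/
theorem patOf_r_getD (isA : Bool) (ℓ : Fin 8 → ℤ) (j : Fin 8) : (patOf isA ℓ).r.getD j 0 = rankOf isA ℓ j := by
  rw [patOf_r]; fin_cases j <;> rfl

omit h in
/-- The fields of `patOf`. [folklore] -/
theorem patOf_E_getD (isA : Bool) (ℓ : Fin 8 → ℤ) {i : ℕ} (hi : i < numCols isA ℓ) : (patOf isA ℓ).E.getD i 0 = evAt isA ℓ i := by
  rw [patOf_E, List.getD_eq_getElem _ _ (by simpa using hi)]; simp

omit h in
/-- The fields of `patOf`. [folklore] -/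
theorem patOf_E_length (isA : Bool) (ℓ : Fin 8 → ℤ) : (patOf isA ℓ).E.length = numCols isA ℓ := by
  simp [patOf_E]

/-- The `B`-events of valid data are the ranks of the letters `7` and `0`. [folklore] -/
theorem BBValid.idxs_zero : idxs 0 (patOf isA ℓ).E 0 = [rankOf isA ℓ 7, rankOf isA ℓ 0] := by
  obtain ⟨e0, e1, e8⟩ := h.mX_ends
  have h70 : rankOf isA ℓ 7 < rankOf isA ℓ 0 := by
    rw [rankOf_lt_rankOf_iff]; simp only [cols]; norm_num; omega
  have hB : ∀ j : Fin 8, ptTag isA j = 0 ↔ j = 0 ∨ j = 7 := by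
    intro j; fin_cases j <;> cases isA <;> simp [ptTag]
  apply idxs_eq_of_mem_iff (by simpa using h70)
  intro a
  rw [mem_idxs_zero, patOf_E_length]
  constructor
  · rintro ⟨ha, ht⟩
    rw [patOf_E_getD _ _ ha, hasTag_evAt_iff (by norm_num)] at ht
    obtain ⟨j, hj, rfl⟩ := ht
    rcases (hB j).mp hj with rfl | rfl <;> simp
  · intro ha
    have ha' : a = rankOf isA ℓ 7 ∨ a = rankOf isA ℓ 0 := by simpa using ha
    have halt : a < numCols isA ℓ := by rcases ha' with rfl | rfl <;> exact rankOf_lt _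
    refine ⟨halt, ?_⟩
    rw [patOf_E_getD _ _ halt, hasTag_evAt_iff (by norm_num)]
    rcases ha' with rfl | rfl
    · exact ⟨7, (hB 7).mpr (Or.inr rfl), rfl⟩
    · exact ⟨0, (hB 0).mpr (Or.inl rfl), rfl⟩

/-- The `T`-events of valid data are the ranks of the two top letters, sorted. [folklore] -/
theorem BBValid.idxs_two {p q : Fin 8} (hp : ptTag isA p = 2) (hq : ptTag isA q = 2) (hpq : p ≠ q)
    (hT : ∀ j : Fin 8, ptTag isA j = 2 ↔ j = p ∨ j = q) :
    idxs 2 (patOf isA ℓ).E 0 = [rankOf isA ℓ p, rankOf isA ℓ q] ∨ idxs 2 (patOf isA ℓ).E 0 = [rankOf isA ℓ q, rankOf isA ℓ p] := by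
  have hne : rankOf isA ℓ p ≠ rankOf isA ℓ q := fun heq => hpq (h.rankOf_injOn (hp.trans hq.symm) heq)
  have hmem : ∀ a, a ∈ idxs 2 (patOf isA ℓ).E 0 ↔ a = rankOf isA ℓ p ∨ a = rankOf isA ℓ q := by
    intro a
    rw [mem_idxs_zero, patOf_E_length]
    constructor
    · rintro ⟨ha, ht⟩
      rw [patOf_E_getD _ _ ha, hasTag_evAt_iff (by norm_num)] at ht
      obtain ⟨j, hj, rfl⟩ := ht
      rcases (hT j).mp hj with rfl | rfl <;> simp
    · intro ha
      have halt : a < numCols isA ℓ := by rcases ha with rfl | rfl <;> exact rankOf_lt _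
      refine ⟨halt, ?_⟩
      rw [patOf_E_getD _ _ halt, hasTag_evAt_iff (by norm_num)]
      rcases ha with rfl | rfl
      · exact ⟨p, hp, rfl⟩
      · exact ⟨q, hq, rfl⟩
  rcases lt_or_gt_of_ne hne with hlt | hlt
  · left; apply idxs_eq_of_mem_iff (by simpa using hlt); intro a; rw [hmem a]; simp
  · right; apply idxs_eq_of_mem_iff (by simpa using hlt); intro a; rw [hmem a]; simp [or_comm]

/-- The `M`-events of valid data are the ranks of the four middle letters, in some order.
[folklore] -/
theorem BBValid.exists_perm {p1 p2 p3 p4 : Fin 8} (h1 : ptTag isA p1 = 1) (h2 : ptTag isA p2 = 1) (h3 : ptTag isA p3 = 1)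
    (h4 : ptTag isA p4 = 1) (h12 : p1 ≠ p2) (h13 : p1 ≠ p3) (h14 : p1 ≠ p4) (h23 : p2 ≠ p3) (h24 : p2 ≠ p4) (h34 : p3 ≠ p4) :
    ∃ σ ∈ perms4, (idxs 1 (patOf isA ℓ).E 0).getD σ.1 0 = rankOf isA ℓ p1 ∧
      (idxs 1 (patOf isA ℓ).E 0).getD σ.2.1 0 = rankOf isA ℓ p2 ∧
      (idxs 1 (patOf isA ℓ).E 0).getD σ.2.2.1 0 = rankOf isA ℓ p3 ∧
      (idxs 1 (patOf isA ℓ).E 0).getD σ.2.2.2 0 = rankOf isA ℓ p4 := by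
  set ms := idxs 1 (patOf isA ℓ).E 0 with hms
  have hmem : ∀ {p : Fin 8}, ptTag isA p = 1 → rankOf isA ℓ p ∈ ms := by
    intro p hp
    rw [hms, mem_idxs_zero, patOf_E_length]
    refine ⟨rankOf_lt p, ?_⟩
    rw [patOf_E_getD _ _ (rankOf_lt p), hasTag_evAt_iff (by norm_num)]
    exact ⟨p, hp, rfl⟩
  have hlen : ms.length = 4 := by
    have := h.tagCount_evAt (tag := 1) (by norm_num)
    rw [← patOf_E, (card_filter_ptTag isA).2.1, tagCount] at this
    -- `idxs` lists exactly the filtered indices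
    have hl : ∀ (E : List ℕ) (i : ℕ), (idxs 1 E i).length = (E.filter fun e => hasTag 1 e).length := by
      intro E; induction E with
      | nil => intro i; rfl
      | cons e E ih => intro i; rw [idxs, List.filter_cons]; split_ifs <;> simp [ih]
    rw [hms, hl]; exact this
  have hnd : ms.Nodup := (pairwise_idxs 1 _ 0).sortedLT.nodup
  -- indices of the four ranks in `ms`
  have hidx : ∀ {p : Fin 8}, ptTag isA p = 1 → ∃ i : Fin 4, ms.getD i 0 = rankOf isA ℓ p := by
    intro p hp
    obtain ⟨i, hi, he⟩ := List.getElem_of_mem (hmem hp)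
    refine ⟨⟨i, by omega⟩, ?_⟩
    rw [Fin.val_mk, List.getD_eq_getElem _ _ hi, he]
  obtain ⟨i1, e1⟩ := hidx h1; obtain ⟨i2, e2⟩ := hidx h2; obtain ⟨i3, e3⟩ := hidx h3; obtain ⟨i4, e4⟩ := hidx h4
  have hinj : ∀ {p q : Fin 8} {i j : Fin 4}, ptTag isA p = 1 → ptTag isA q = 1 → p ≠ q →
      ms.getD i 0 = rankOf isA ℓ p → ms.getD j 0 = rankOf isA ℓ q → i ≠ j := by
    intro p q i j hp hq hpq ei ej hij
    subst hij
    rw [ei] at ej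
    exact hpq (h.rankOf_injOn (hp.trans hq.symm) ej)
  refine ⟨(i1, i2, i3, i4), mem_perms4 i1 i2 i3 i4 ⟨hinj h1 h2 h12 e1 e2, hinj h1 h3 h13 e1 e3, hinj h1 h4 h14 e1 e4,
    hinj h2 h3 h23 e2 e3, hinj h2 h4 h24 e2 e4, hinj h3 h4 h34 e3 e4⟩, e1, e2, e3, e4⟩

omit h in
/-- The labelled pattern of building-block data is consistent. [cite: Rechnitzer2006Haruspicy2, Lemma 21] -/
theorem pconsistent_patOf (isA : Bool) (ℓ : Fin 8 → ℤ) : pconsistent isA (patOf isA ℓ).E (patOf isA ℓ).r = true := by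
  rw [pconsistent]
  simp only [Bool.and_eq_true, beq_iff_eq, List.all_eq_true, List.mem_range, Nat.blt_eq, Bool.or_eq_true,
    Bool.not_eq_true', List.any_eq_true, patOf_E_length]
  refine ⟨⟨by rw [patOf_r]; rfl, fun j hj => ?_⟩, fun i hi => ⟨⟨evAt_pos hi |> fun h1 => ?_, ?_⟩, fun tag htag => ?_⟩⟩
  · rw [show (patOf isA ℓ).r.getD j 0 = rankOf isA ℓ ⟨j, hj⟩ from patOf_r_getD isA ℓ ⟨j, hj⟩]
    refine ⟨rankOf_lt _, ?_⟩
    rw [patOf_E_getD _ _ (rankOf_lt _), hasTag_evAt_iff (ptTag_lt _ _)]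
    exact ⟨⟨j, hj⟩, rfl, rfl⟩
  · rw [patOf_E_getD _ _ hi]; exact h1
  · rw [patOf_E_getD _ _ hi]; exact evAt_lt i
  · rw [patOf_E_getD _ _ hi]
    by_cases hh : hasTag tag (evAt isA ℓ i) = true
    · right
      obtain ⟨j, hjt, hji⟩ := (hasTag_evAt_iff htag i).mp hh
      exact ⟨j, j.isLt, by rw [hjt, show (patOf isA ℓ).r.getD j 0 = rankOf isA ℓ j from patOf_r_getD isA ℓ j, hji]; simp⟩
    · left; simpa using hh

/-- **Completeness of the enumeration**: the labelled pattern of valid building-block data is one of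
the `540` valid labelled patterns. [cite: Rechnitzer2006Haruspicy2, Lemma 21] -/
theorem BBValid.patOf_mem_validPats : patOf isA ℓ ∈ validPats := by
  have hpos := numCols_pos (isA := isA) (ℓ := ℓ)
  -- the event sequence, head and tail
  set m := numCols isA ℓ with hm
  obtain ⟨m', hm'⟩ : ∃ m', m = m' + 1 := ⟨m - 1, by omega⟩
  have hE : (patOf isA ℓ).E = evAt isA ℓ 0 :: (List.range m').map (fun i => evAt isA ℓ (i + 1)) := by
    rw [patOf_E, ← hm, hm', List.range_succ_eq_map, List.map_cons, List.map_map]; rfl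
  have hev : ∀ e' ∈ (List.range m').map (fun i => evAt isA ℓ (i + 1)), 1 ≤ e' ∧ e' ≤ 7 := by
    intro e' he'
    rw [List.mem_map] at he'
    obtain ⟨i, hi, rfl⟩ := he'
    rw [List.mem_range] at hi
    exact ⟨evAt_pos (by omega), by have := evAt_lt (isA := isA) (ℓ := ℓ) (i + 1); omega⟩
  have hcount : ∀ tag < 3, tagCount tag ((List.range m').map (fun i => evAt isA ℓ (i + 1))) =
      (univ.filter fun j : Fin 8 => ptTag isA j = tag).card - (if hasTag tag (evAt isA ℓ 0) then 1 else 0) := by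
    intro tag htag
    have := h.tagCount_evAt htag
    rw [← patOf_E, hE, tagCount_cons] at this
    omega
  obtain ⟨c0, c1, c2⟩ := card_filter_ptTag isA
  refine mem_validPats_of (evAt_pos hpos) (by have := evAt_lt (isA := isA) (ℓ := ℓ) 0; omega) hE ?_ ?_
    (pconsistent_patOf isA ℓ)
  · -- the chunk
    refine mem_seqsChunk hev (by rw [List.length_map, List.length_range]; have := numCols_le (isA := isA) (ℓ := ℓ); omega)
      ?_ ?_ ?_
    · rw [hcount 0 (by norm_num), c0]
    · rw [hcount 1 (by norm_num), c1]
    · rw [hcount 2 (by norm_num), c2]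
  · -- the candidate ranks
    show (patOf isA ℓ).r ∈ candRanks isA (patOf isA ℓ).E
    rw [patOf_r]
    cases isA
    · refine mem_candRanks_false h.idxs_zero (h.idxs_two (p := 4) (q := 5) rfl rfl (by decide)
        (fun j => by fin_cases j <;> simp [ptTag])) ?_ h.valid8_rankOf
      exact h.exists_perm (p1 := 1) (p2 := 2) (p3 := 3) (p4 := 6) rfl rfl rfl rfl (by decide) (by decide) (by decide)
        (by decide) (by decide) (by decide)
    · refine mem_candRanks_true h.idxs_zero (h.idxs_two (p := 2) (q := 3) rfl rfl (by decide)
        (fun j => by fin_cases j <;> simp [ptTag])) ?_ h.valid8_rankOf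
      exact h.exists_perm (p1 := 1) (p2 := 4) (p3 := 5) (p4 := 6) rfl rfl rfl rfl (by decide) (by decide) (by decide)
        (by decide) (by decide) (by decide)

end Completeness

/-! ### The data of the pattern of valid data are the data (round trip on data) -/

section RoundTrip1

open Finset

variable {isA : Bool} {ℓ : Fin 8 → ℤ}

/-- Consecutive sorted columns increase. [folklore] -/
theorem sortedCols_lt_succ {i : ℕ} (hi : i + 1 < numCols isA ℓ) :
    (sortedCols isA ℓ)[i]'(by unfold numCols at hi; omega) < (sortedCols isA ℓ)[i + 1]'hi :=
  (sortedLT_sortedCols.getElem_lt_getElem_iff).mpr (Nat.lt_succ_self i)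

/-- The gaps are positive. [folklore] -/
theorem bbGap_pos {i : ℕ} (hi : i + 1 < numCols isA ℓ) : 1 ≤ bbGap isA ℓ i := by
  have := sortedCols_lt_succ hi
  rw [bbGap, List.getD_eq_getElem _ _ hi, List.getD_eq_getElem _ _ (by unfold numCols at hi; omega)]
  omega

/-- The partial sums of the gaps are the sorted columns, relative to the leftmost. [folklore] -/
theorem posOf_bbGap {i : ℕ} (hi : i < numCols isA ℓ) :
    posOf (bbGap isA ℓ) i = (sortedCols isA ℓ)[i]'hi - (sortedCols isA ℓ)[0]'numCols_pos := by
  induction i with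
  | zero => simp [posOf]
  | succ i ih =>
    have := sortedCols_lt_succ hi
    rw [posOf_succ, ih (by omega), bbGap, List.getD_eq_getElem _ _ hi,
      List.getD_eq_getElem _ _ (by unfold numCols at hi; omega)]
    omega

/-- The columns of the pattern of valid data with its own gaps are the columns. [folklore] -/
theorem BBValid.colOf_patOf (h : BBValid isA ℓ) {k : ℕ} (hk : k ≤ 8) :
    colOf (patOf isA ℓ) (bbGap isA ℓ) k = mX (bbMoves isA ℓ) k := by
  obtain ⟨e0, -, e8⟩ := h.mX_ends
  have h7 : (patOf isA ℓ).r.getD 7 0 = rankOf isA ℓ 7 := patOf_r_getD isA ℓ 7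
  have hc7 : cols isA ℓ 7 = 0 := e8
  rcases Nat.eq_zero_or_pos k with rfl | hpos
  · rw [colOf_zero, e0]
  · have hrk : rk (patOf isA ℓ).r k = rankOf isA ℓ ⟨k - 1, by omega⟩ := by
      rcases Nat.lt_or_ge k 8 with h8 | h8
      · rw [rk_of_pos _ hpos (by omega)]; exact patOf_r_getD isA ℓ ⟨k - 1, by omega⟩
      · have : k = 8 := by omega
        subst this; rw [rk_eight, h7]; rfl
    rw [colOf, hrk, h7, posOf_bbGap (rankOf_lt _), posOf_bbGap (rankOf_lt _), getElem_rankOf, getElem_rankOf, hc7]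
    simp only [cols, sub_zero, sub_sub_sub_cancel_right]
    congr 1; omega

/-- **The data of the pattern of valid data, with its own gaps, are the data.**
[cite: Rechnitzer2006Haruspicy2, Lemma 21] -/
theorem BBValid.ellOf_patOf (h : BBValid isA ℓ) : ellOf (patOf isA ℓ) (bbGap isA ℓ) = ℓ := by
  funext k
  rw [show ellOf (patOf isA ℓ) (bbGap isA ℓ) k = colOf (patOf isA ℓ) (bbGap isA ℓ) (k + 1) - colOf (patOf isA ℓ) (bbGap isA ℓ) k
      from rfl, h.colOf_patOf (by omega), h.colOf_patOf (by omega), mX_succ _ (by simp),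
    show mL (bbMoves isA ℓ) k = ℓ k from mL_bbMoves isA ℓ k]
  ring

end RoundTrip1

/-! ### The statistics of the data of a pattern are linear in the gaps -/

section Stats

open Finset

variable {P : LPat} (hP : PProps P) {n : ℕ → ℕ} (hn : ∀ i < P.E.length - 1, 1 ≤ n i)
include hP hn

omit hn in
/-- Ranks of run ends are at most the number of gaps. [folklore] -/
theorem PProps.rk_le (k : ℕ) : rk P.r k ≤ P.E.length - 1 := by have := hP.rk_lt k; omega

omit hn in
/-- **The runs are sums of the gaps they cover.** [folklore] -/
theorem PProps.natAbs_ellOf (k : Fin 8) :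
    (ellOf P n k).natAbs = ∑ i ∈ range (P.E.length - 1), if covers P.r k i then n i else 0 := by
  rw [show ellOf P n k = colOf P n (k + 1) - colOf P n k from rfl, colOf, colOf, sub_sub_sub_cancel_right,
    natAbs_posOf_sub n (hP.rk_le k) (hP.rk_le (k + 1))]
  refine Finset.sum_congr rfl fun i _ => ?_
  simp only [covers, Bool.and_eq_true, Nat.ble_eq, Nat.blt_eq]

omit hn in
/-- The top row is the sum of the gaps under it. [cite: Rechnitzer2006Haruspicy2, Lemma 21] -/
theorem PProps.natAbs_ellOf_top :
    (ellOf P n (bbTop P.isA)).natAbs = ∑ i ∈ range (P.E.length - 1), n i * wa P i := by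
  rw [hP.natAbs_ellOf]
  refine Finset.sum_congr rfl fun i _ => ?_
  rw [wa, show ((bbTop P.isA : Fin 8) : ℕ) = topIdx P.isA by cases P.isA <;> rfl]
  split_ifs <;> simp

omit hn in
/-- The bottom row is the sum of the gaps under it. [cite: Rechnitzer2006Haruspicy2, Lemma 21] -/
theorem PProps.ellOf_zero : ellOf P n 0 = ∑ i ∈ range (P.E.length - 1), ((n i * wb P i : ℕ) : ℤ) := by
  have h70 := hP.r7_lt
  rw [show ellOf P n 0 = colOf P n 1 - colOf P n 0 from rfl, colOf_zero, sub_zero, colOf, rk_of_pos P le_rfl (by norm_num),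
    Nat.sub_self, posOf_sub_posOf n h70.le (N := P.E.length - 1) (by have := hP.rlt 0 (by norm_num); omega)]
  refine Finset.sum_congr rfl fun i _ => ?_
  rw [wb, covers, rk_zero, rk_of_pos P le_rfl (by norm_num), Nat.sub_self, min_eq_left h70.le, max_eq_right h70.le]
  by_cases hc : P.r.getD 7 0 ≤ i ∧ i < P.r.getD 0 0
  · rw [if_pos hc, if_pos (by simpa [Nat.ble_eq, Nat.blt_eq] using hc)]; simp
  · rw [if_neg hc, if_neg (by simpa [Nat.ble_eq, Nat.blt_eq] using hc)]; simp

omit hn in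
/-- The horizontal letters are the sum of the coverages of the gaps. [cite: Rechnitzer2006Haruspicy2, Lemma 21] -/
theorem PProps.sum_natAbs_ellOf :
    ∑ k : Fin 8, (ellOf P n k).natAbs = ∑ i ∈ range (P.E.length - 1), n i * cov P.r i := by
  simp_rw [hP.natAbs_ellOf]
  rw [Finset.sum_comm]
  refine Finset.sum_congr rfl fun i _ => ?_
  -- `Σ_k [k covers i] · n i = n i · #{k : k covers i}`
  have hcov : cov P.r i = ((Finset.range 8).filter fun k => covers P.r k i = true).card := by
    rw [cov, ← List.toFinset_card_of_nodup (List.nodup_range.filter _), List.toFinset_filter, List.toFinset_range]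
  rw [Fin.sum_univ_eq_sum_range (fun k => if covers P.r k i = true then n i else 0) 8, hcov, Finset.card_filter,
    Finset.mul_sum]
  exact Finset.sum_congr rfl fun k _ => by split_ifs <;> simp

end Stats

/-! ### The count: building-block words by valid pattern and gap vector -/

section Count

open Finset

/-- **Coverage bookkeeping** (from the data check `pgood`): `cov_i = 2(e_i + a_i) ≥ 2`. [folklore] -/
theorem cov_eq_of_mem {P : LPat} (h : P ∈ validPats) {i : ℕ} (hi : i < P.E.length - 1) :
    cov P.r i = 2 * (we P i + wa P i) ∧ 2 ≤ cov P.r i := by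
  have hg := pgood_of_mem h
  simp only [pgood, List.all_eq_true, List.mem_range, Bool.and_eq_true, beq_iff_eq, Nat.ble_eq] at hg
  obtain ⟨⟨h1, h2⟩, h3⟩ := hg i hi
  refine ⟨?_, h2⟩
  rw [we]; omega

/-- `ellOf` only depends on the gaps below the number of gaps. [folklore] -/
theorem PProps.ellOf_congr {P : LPat} (hP : PProps P) {n n' : ℕ → ℕ} (h : ∀ i < P.E.length - 1, n i = n' i) :
    ellOf P n = ellOf P n' := by
  have hpos : ∀ a ≤ P.E.length - 1, posOf n a = posOf n' a := fun a ha =>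
    Finset.sum_congr rfl fun i hi => by rw [Finset.mem_range] at hi; rw [h i (by omega)]
  have hcol : ∀ k, colOf P n k = colOf P n' k := fun k => by
    rw [colOf, colOf, hpos _ (hP.rk_le k), hpos _ (by have := hP.rlt 7 (by norm_num); omega)]
  funext k
  show colOf P n (k + 1) - colOf P n k = colOf P n' (k + 1) - colOf P n' k
  rw [hcol, hcol]

/-- Extending a gap vector by zero. [folklore] -/
def extGap {m : ℕ} (v : Fin m → ℕ) : ℕ → ℕ := fun i => if h : i < m then v ⟨i, h⟩ else 0

/-- `extGap` on the range. [folklore] -/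
theorem extGap_of_lt {m : ℕ} (v : Fin m → ℕ) {i : ℕ} (hi : i < m) : extGap v i = v ⟨i, hi⟩ := by
  simp [extGap, hi]

/-- The gap vectors of a pattern with entries in `[1, B]` producing top row `t`, bottom row `w`
and horizontal half-perimeter `M` (`= Σ n_i e_i + t`). [cite: Rechnitzer2006Haruspicy2, Lemma 21] -/
def gapVecs (P : LPat) (B M t w : ℕ) : Finset (Fin (ngaps P) → ℕ) :=
  (Fintype.piFinset fun _ : Fin (ngaps P) => Finset.Icc 1 B).filter fun v =>
    ∑ i : Fin (ngaps P), v i * wa P i = t ∧ ∑ i : Fin (ngaps P), v i * wb P i = w ∧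
      ∑ i : Fin (ngaps P), v i * we P i + t = M

/-- The word of a pattern and a gap vector. [cite: Rechnitzer2006Haruspicy2, Lemma 21] -/
def wordOf (P : LPat) (v : Fin (ngaps P) → ℕ) : List (Fin 4) := movesWord (bbMoves P.isA (ellOf P (extGap v)))

/-- Sums over `Fin (ngaps P)` and over `range`. [folklore] -/
theorem sum_extGap {P : LPat} (v : Fin (ngaps P) → ℕ) (c : ℕ → ℕ) :
    ∑ i ∈ range (P.E.length - 1), extGap v i * c i = ∑ i : Fin (ngaps P), v i * c i := by
  rw [show P.E.length - 1 = ngaps P from rfl, ← Fin.sum_univ_eq_sum_range]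
  exact Finset.sum_congr rfl fun i _ => by rw [extGap_of_lt v i.isLt]

/-- **The statistics of the word of a valid pattern and gaps.** [cite: Rechnitzer2006Haruspicy2, Lemma 21] -/
theorem stats_wordOf {P : LPat} (hmem : P ∈ validPats) (v : Fin (ngaps P) → ℕ) :
    (ellOf P (extGap v) (bbTop P.isA)).natAbs = ∑ i : Fin (ngaps P), v i * wa P i ∧
    ellOf P (extGap v) 0 = ((∑ i : Fin (ngaps P), v i * wb P i : ℕ) : ℤ) ∧
    ∑ k : Fin 8, (ellOf P (extGap v) k).natAbs =
      2 * (∑ i : Fin (ngaps P), v i * we P i + ∑ i : Fin (ngaps P), v i * wa P i) := by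
  have hP := PProps.of_mem hmem
  refine ⟨by rw [hP.natAbs_ellOf_top, sum_extGap], by rw [hP.ellOf_zero, ← sum_extGap, Nat.cast_sum], ?_⟩
  rw [hP.sum_natAbs_ellOf, ← sum_extGap v (we P), ← sum_extGap v (wa P), mul_add, Finset.mul_sum, Finset.mul_sum,
    ← Finset.sum_add_distrib]
  refine Finset.sum_congr rfl fun i hi => ?_
  rw [Finset.mem_range] at hi
  rw [(cov_eq_of_mem hmem hi).1]; ring

/-- The word of a valid pattern and positive gaps is a building-block word with the predicted
statistics. [cite: Rechnitzer2006Haruspicy2, Lemma 21] -/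
theorem wordOf_mem_bbWords {P : LPat} (hmem : P ∈ validPats) {B M t w : ℕ} {v : Fin (ngaps P) → ℕ}
    (hv : v ∈ gapVecs P B M t w) : wordOf P v ∈ bbWords M t w := by
  rw [gapVecs, Finset.mem_filter, Fintype.mem_piFinset] at hv
  obtain ⟨hvB, ht, hw, hM⟩ := hv
  have hn : ∀ i < P.E.length - 1, 1 ≤ extGap v i := fun i hi => by
    rw [extGap_of_lt v hi]; exact (Finset.mem_Icc.mp (hvB ⟨i, hi⟩)).1
  obtain ⟨s1, s2, s3⟩ := stats_wordOf hmem v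
  refine (bbValid_ellOf hmem hn).mem_bbWords ?_ ?_ ?_
  · rw [s3, ht, hM]
  · rw [s1, ht]
  · rw [s2, hw]

/-- The gaps recovered from the word of a valid pattern. [folklore] -/
theorem bbGap_wordOf {P : LPat} (hmem : P ∈ validPats) {v : Fin (ngaps P) → ℕ}
    (hn : ∀ i < P.E.length - 1, 1 ≤ extGap v i) (i : Fin (ngaps P)) :
    bbGap P.isA (ellOf P (extGap v)) i = v i := by
  rw [(PProps.of_mem hmem).bbGap_ellOf hn (by have := i.isLt; unfold ngaps at this; omega), extGap_of_lt v i.isLt]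

/-- Every building-block word is the word of a valid pattern and a gap vector with the right
statistics. [cite: Rechnitzer2006Haruspicy2, Lemma 21] -/
theorem exists_wordOf_eq {M t w : ℕ} {W : List (Fin 4)} (hW : W ∈ bbWords M t w) :
    ∃ P ∈ validPats, ∃ v ∈ gapVecs P (2 * M) M t w, wordOf P v = W := by
  obtain ⟨isA, ℓ, hvalid, hWeq, hM, ht, hw⟩ := exists_bbValid_of_mem_bbWords hW
  obtain ⟨P, hP⟩ : ∃ P, patOf isA ℓ = P := ⟨_, rfl⟩
  have hmem : P ∈ validPats := hP ▸ hvalid.patOf_mem_validPats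
  have hPA : P.isA = isA := by rw [← hP]; rfl
  have hlenE : P.E.length = numCols isA ℓ := by rw [← hP]; exact patOf_E_length isA ℓ
  have hround : ellOf P (bbGap isA ℓ) = ℓ := by rw [← hP]; exact hvalid.ellOf_patOf
  have hprops := PProps.of_mem hmem
  let v : Fin (ngaps P) → ℕ := fun i => bbGap isA ℓ i
  have hext : ∀ i < P.E.length - 1, extGap v i = bbGap isA ℓ i := fun i hi => extGap_of_lt v hi
  have hℓ : ellOf P (extGap v) = ℓ := by rw [hprops.ellOf_congr hext]; exact hround
  obtain ⟨s1, s2, s3⟩ := stats_wordOf hmem v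
  rw [hℓ, hPA, ht] at s1
  rw [hℓ, hw] at s2
  rw [hℓ, hM] at s3
  refine ⟨P, hmem, v, ?_, by rw [wordOf, hℓ, hPA]; exact hWeq⟩
  rw [gapVecs, Finset.mem_filter, Fintype.mem_piFinset]
  have hng : ngaps P + 1 = numCols isA ℓ := by
    have := numCols_pos (isA := isA) (ℓ := ℓ); rw [ngaps, hlenE]; omega
  have hpos : ∀ i : Fin (ngaps P), 1 ≤ v i := fun i =>
    bbGap_pos (by have := i.isLt; omega)
  have htot : ∑ j : Fin (ngaps P), v j * cov P.r j = 2 * M := by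
    rw [← sum_extGap, ← hprops.sum_natAbs_ellOf, hℓ, hM]
  refine ⟨fun i => Finset.mem_Icc.mpr ⟨hpos i, ?_⟩, s1.symm, by exact_mod_cast s2.symm, by omega⟩
  have hcov := cov_eq_of_mem hmem (i := i) i.isLt
  have hle : v i * cov P.r i ≤ ∑ j : Fin (ngaps P), v j * cov P.r j :=
    Finset.single_le_sum (f := fun j : Fin (ngaps P) => v j * cov P.r j) (fun j _ => Nat.zero_le _) (Finset.mem_univ i)
  nlinarith [hcov.2, hpos i]

/-- The word of a valid pattern determines the gap vector (and the pattern). [folklore] -/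
theorem wordOf_injective {P Q : LPat} (hP : P ∈ validPats) (hQ : Q ∈ validPats) {B M t w B' M' t' w' : ℕ}
    {v : Fin (ngaps P) → ℕ} {u : Fin (ngaps Q) → ℕ} (hv : v ∈ gapVecs P B M t w) (hu : u ∈ gapVecs Q B' M' t' w')
    (h : wordOf P v = wordOf Q u) : (⟨P, v⟩ : Σ P : LPat, Fin (ngaps P) → ℕ) = ⟨Q, u⟩ := by
  obtain ⟨hA, hℓ⟩ := movesWord_bbMoves_injective h
  have hnx : ∀ i < P.E.length - 1, 1 ≤ extGap v i := fun i hi => by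
    rw [extGap_of_lt v hi]
    exact (Finset.mem_Icc.mp ((Fintype.mem_piFinset.mp (Finset.mem_filter.mp hv).1) ⟨i, hi⟩)).1
  have hny : ∀ i < Q.E.length - 1, 1 ≤ extGap u i := fun i hi => by
    rw [extGap_of_lt u hi]
    exact (Finset.mem_Icc.mp ((Fintype.mem_piFinset.mp (Finset.mem_filter.mp hu).1) ⟨i, hi⟩)).1
  have hPQ : P = Q := by
    rw [← (PProps.of_mem hP).patOf_ellOf hnx, ← (PProps.of_mem hQ).patOf_ellOf hny, hA, hℓ]
  subst hPQ
  have huv : v = u := by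
    funext i
    rw [← bbGap_wordOf hP hnx i, ← bbGap_wordOf hP hny i, hℓ]
  subst huv
  rfl

set_option linter.constructorNameAsVariable false in
/-- **Lemma 21, the count**: the building-block words with horizontal half-perimeter `M`, top row
`t` and bottom row `w` correspond bijectively to the pairs (valid labelled pattern, gap vector with
the corresponding linear statistics). [cite: Rechnitzer2006Haruspicy2, Lemma 21] -/
theorem card_bbWords_eq_sum (M t w : ℕ) :
    (bbWords M t w).card = ∑ P ∈ validPats.toFinset, (gapVecs P (2 * M) M t w).card := by
  classical
  rw [← Finset.card_sigma]
  symm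
  refine Finset.card_bij (fun x _ => wordOf x.1 x.2) (fun x hx => ?_) (fun x hx y hy hxy => ?_) (fun W hW => ?_)
  · rw [Finset.mem_sigma, List.mem_toFinset] at hx
    exact wordOf_mem_bbWords hx.1 hx.2
  · rw [Finset.mem_sigma, List.mem_toFinset] at hx hy
    exact wordOf_injective hx.1 hy.1 hx.2 hy.2 hxy
  · obtain ⟨P, hP, v, hv, hPv⟩ := exists_wordOf_eq hW
    exact ⟨⟨P, v⟩, by rw [Finset.mem_sigma, List.mem_toFinset]; exact ⟨hP, hv⟩, hPv⟩

end Count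

end

end Haruspicy

end Literature.Barriers.CriticalPhenomena
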